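/-
Copyright: literature port (parity-ideate cell, ROUND-24 Phase B).  Trunk: AntSieve / parity.S13.
-/
import Literature.NumberTheory.Sieve.PolymathProdRadialSym
import Literature.NumberTheory.Sieve.PolymathSimplexHornerZ
import Literature.Analysis.Convolution.KroneckerSignedDigits
import HarnessLib

/-!
# The kernel checker for LABELLED product-radial ("orbital") certificates `M_{k+1,ε} > 4`, and its soundness

D. H. J. Polymath, *Variants of the Selberg sieve, and bounded intervals containing many primes*, Res. Math. Sci. 1:12
(2014) = arXiv:1407.4897, §7 (the numerical lower bounds for `M_{k,ε}`, Theorem 3.13 / eq. (35)), in the compressed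
form used by the cell's ROUND-22/24 certificates: the test function is
`F = 1_{(1+ε)•R_{k+1}} · Σ_p Q_p(1+ε − Σt) · Sym_{k+1}[sg p](t)` where every slot carries one profile out of a finite
alphabet `φ_0 = g` (base), `φ_1, …` (arbitrary one-variable polynomials with dyadic coefficients), `sg p` says how many
slots of generator `p` carry which profile, and `Q_p ∈ ℤ[X]`.

* `SymLCert` — the certificate data: `k`, `ε = en/ed`, degrees `S`, `A`, dyadic scale `T`, digit headroom `H`, the
  integer profile table, the generators `(E_p, Q_p)`, the `k`-slot signatures of the `J`-side with the pointing map,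
  the aggregated `J`-side convolution table, and — per pair — the list of OVERLAP CLASSES (joint multiplicity matrices,
  `PolymathProdRadialSym.jointClasses`), which the checker VERIFIES (marginals, distinctness, and the mass identity
  `jointClasses_eq_of_sum_multinomial_eq`) instead of enumerating;
* `SymLCert.okI x y v`, `SymLCert.okJ a b v`, `SymLCert.checkTab` — closed `ℕ`/`ℤ` programs (structural recursions, GMP
  arithmetic, no `Finset`/`Polynomial`/`ℝ`): per pair, the class sum of products of SIGNED Kronecker packs
  (`KroneckerSignedDigits`), offset digits, the signed Horner evaluator `ZvalZ` (`PolymathSimplexHornerZ`) for the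
  Dirichlet functional, assembled exactly as in the one-profile checker `ProdCert` (`PolymathProdRadialCert`);
* **`SymLCert.sound_tab`** — per-pair kernel facts `okI = true`, `okJ = true` (one `decide +kernel` each) and
  `checkTab = true` give `∃ ε F, IsPolymathTestFunction (k+1) ε F ∧ 4 < polymathFunctional (k+1) ε F`, through
  `SymLData.exists_polymathFunctional_gt_four` (`PolymathProdRadialSym`).

No numerics are run in this file and no named facts are introduced; a concrete certificate is a separate file of data +
`decide +kernel` tables.

## References
* D. H. J. Polymath, Res. Math. Sci. 1 (2014), Art. 12; arXiv:1407.4897: §7.1–7.2, Lemma 7.2, Theorem 3.13, eq. (35). [Polymath8b2014]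
* J. von zur Gathen, J. Gerhard, *Modern Computer Algebra*, 3rd ed., CUP 2013, §8.4 (Kronecker substitution). [GathenGerhard2013ModernComputerAlgebra]
-/

open Polynomial
open scoped BigOperators

namespace Literature.NumberTheory.Sieve.PolymathCert

/-! ## Part A — the certificate data and the kernel program -/

section KernelProgram

/-- `Π_{i<n} f i` over `ℕ` by structural recursion (kernel-evaluable). [cite: Polymath8b2014, Theorem 3.13, eq. (35)] -/
def nprod (f : ℕ → ℕ) : ℕ → ℕ
  | 0 => 1
  | n + 1 => nprod f n * f n

/-- `Π_{i<n} f i` over `ℤ` by structural recursion. [cite: Polymath8b2014, Theorem 3.13, eq. (35)] -/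
def zprod (f : ℕ → ℤ) : ℕ → ℤ
  | 0 => 1
  | n + 1 => zprod f n * f n

/-- number of occurrences of the label `s` in a list of labels. [cite: Polymath8b2014, Section 7.1] -/
def lcount (s : ℕ) : List ℕ → ℕ
  | [] => 0
  | l :: ls => lcount s ls + if l = s then 1 else 0

/-- entry `(s,t)` of an overlap class given as a list of entries `(s, t, e)` (entries with the same key add up).
[cite: Polymath8b2014, Section 7.1] -/
def centry (s t : ℕ) : List (ℕ × ℕ × ℕ) → ℕ
  | [] => 0
  | e :: es => centry s t es + if e.1 = s ∧ e.2.1 = t then e.2.2 else 0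

end KernelProgram

/-- A labelled product-radial certificate.  Profiles: `prof[s] = (Φ_{s,0}, …, Φ_{s,S})`, `φ_s = 2^{-T} Σ_j Φ_{s,j} u^j`,
`s = 0` the base profile.  Generators: `gens[x] = (E_x, Q_x)`, `E_x` the multiset of NON-base labels of the excited
slots (a list of label indices `≥ 1`, repetition = multiplicity; the other `k+1−|E_x|` slots carry the base profile),
`Q_x = Σ_{i≤A} Q_x[i] X^i ∈ ℤ[X]`.  `J`-side: `sigJ[a]` = a `k`-slot signature (again as a multiset of non-base labels),
`jx[x][s]` = the index in `sigJ` of `sg x − e_s` (read only when profile `s` occurs in `sg x`), `wv[a][N]` = the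
aggregated convolution table `2^T (A+S+1)! · [X^N] Σ_{(x,s) ↦ a} T_{φ_s} Q_x`.  Classes: `clsI[x·G + y]` (`y ≤ x`), resp.
`clsJ[a·NJ + b]` (`b ≤ a`), = the list of overlap classes of the pair, each a list of entries `(s, t, e)`: `e` slots carry
profile `s` in the first factor and `t` in the second.  `H`: the signed Kronecker digits have base `2^{H+1}` and offset
`2^H`. [cite: Polymath8b2014, Theorem 3.13, eq. (35)] -/
structure SymLCert where
  /-- `J`-side slot count; the test function lives on `R_{k+1}` -/
  k : ℕ
  /-- `ε = en/ed`: numerator -/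
  en : ℕ
  /-- `ε = en/ed`: denominator -/
  ed : ℕ
  /-- profile degree bound -/
  S : ℕ
  /-- radial degree bound -/
  A : ℕ
  /-- dyadic scale of the profiles -/
  T : ℕ
  /-- digit headroom -/
  H : ℕ
  /-- integer profile coefficients -/
  prof : List (List ℤ)
  /-- generators `(E_x, Q_x)` -/
  gens : List (List ℕ × List ℤ)
  /-- `k`-slot signatures of the `J`-side -/
  sigJ : List (List ℕ)
  /-- pointing map `(x, s) ↦ a` -/
  jx : List (List ℕ)
  /-- aggregated convolution table -/
  wv : List (List ℤ)
  /-- overlap classes, `I`-side pairs -/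
  clsI : List (List (List (ℕ × ℕ × ℕ)))
  /-- overlap classes, `J`-side pairs -/
  clsJ : List (List (List (ℕ × ℕ × ℕ)))

namespace SymLCert

variable (C : SymLCert)

section Program

/-! ### Sizes, profiles, generators, signatures -/

/-- number of labels. [cite: Polymath8b2014, Theorem 3.13, eq. (35)] -/
def nL : ℕ := C.prof.length
/-- number of generators. [cite: Polymath8b2014, Theorem 3.13, eq. (35)] -/
def G : ℕ := C.gens.length
/-- number of `J`-side signatures. [cite: Polymath8b2014, Theorem 3.13, eq. (35)] -/
def NJ : ℕ := C.sigJ.length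
/-- digit width `B = H + 1`. [cite: GathenGerhard2013ModernComputerAlgebra, Section 8.4] -/
def B : ℕ := C.H + 1
/-- number of coefficients of `Ĥ_{st}`. [cite: Polymath8b2014, Lemma 4.4] -/
def M : ℕ := 2 * C.S + 1
/-- degree bound of the `J`-side products `W_a W_b`. [cite: Polymath8b2014, Lemma 4.4] -/
def Cmax : ℕ := 2 * (C.A + C.S + 1)
/-- degree bound of an `n`-slot class polynomial. [cite: Polymath8b2014, Lemma 4.4] -/
def L (n : ℕ) : ℕ := n * (2 * C.S)
/-- `Φ_{s,j}` (zero beyond `S`). [cite: Polymath8b2014, Theorem 3.13, eq. (35)] -/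
def a (s j : ℕ) : ℤ := if j ≤ C.S then (C.prof.getD s []).getD j 0 else 0
/-- the excitation multiset `E_x`. [cite: Polymath8b2014, Section 7.2] -/
def E (x : ℕ) : List ℕ := (C.gens.getD x ([], [])).1
/-- `Q_x[i]` (zero beyond `A`). [cite: Polymath8b2014, Theorem 3.13, eq. (35)] -/
def q (x i : ℕ) : ℤ := if i ≤ C.A then (C.gens.getD x ([], [])).2.getD i 0 else 0
/-- the `J`-side signature multiset `E'_a`. [cite: Polymath8b2014, Section 7.2] -/
def EJ (a : ℕ) : List ℕ := C.sigJ.getD a []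
/-- the `(k+1)`-slot signature of generator `x`: `sg x s`. [cite: Polymath8b2014, Section 7.2] -/
def sgc (x s : ℕ) : ℕ := if s = 0 then C.k + 1 - (C.E x).length else lcount s (C.E x)
/-- the `k`-slot signature number `a`. [cite: Polymath8b2014, Section 7.2] -/
def sgJc (a s : ℕ) : ℕ := if s = 0 then C.k - (C.EJ a).length else lcount s (C.EJ a)
/-- the pointing map. [cite: Polymath8b2014, Section 7.2] -/
def jxf (x s : ℕ) : ℕ := (C.jx.getD x []).getD s 0

/-! ### The integer pair polynomials `Ĥ_{st}` and their signed packs -/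

/-- `Ĥ_{st,m} = m! Σ_j Φ_{s,j} Φ_{t,m−j}` (`= 2^{2T} [u^m] hat(φ_s φ_t)`). [cite: Polymath8b2014, Lemma 4.4] -/
def Hc (s t m : ℕ) : ℤ := m.factorial * zsum (fun j => C.a s j * C.a t (m - j)) (m + 1)
/-- `ℓ¹(Ĥ_{st}) = Σ_m |Ĥ_{st,m}|`. [cite: GathenGerhard2013ModernComputerAlgebra, Section 8.4] -/
def Habs (s t : ℕ) : ℕ := nsum (fun m => (C.Hc s t m).natAbs) C.M
/-- the signed Kronecker pack `Ĥ_{st}(2^B)`. [cite: GathenGerhard2013ModernComputerAlgebra, Section 8.4] -/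
def PK (s t : ℕ) : ℤ := zsum (fun m => C.Hc s t m * (pow2 (C.B * m) : ℕ)) C.M

/-! ### Overlap classes (supplied, verified) -/

/-- `Π_{s,t} M(s,t)!`. [cite: Polymath8b2014, Section 7.1] -/
def cfact (κ : List (ℕ × ℕ × ℕ)) : ℕ := nprod (fun s => nprod (fun t => (centry s t κ).factorial) C.nL) C.nL
/-- the class multiplicity `n!/Π M(s,t)!`. [cite: Polymath8b2014, Section 7.1] -/
def cmult (n : ℕ) (κ : List (ℕ × ℕ × ℕ)) : ℕ := n.factorial / C.cfact κ
/-- the class pack `Π_{s,t} Ĥ_{st}(2^B)^{M(s,t)}`. [cite: Polymath8b2014, Section 7.1] -/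
def cpk (κ : List (ℕ × ℕ × ℕ)) : ℤ := zprod (fun s => zprod (fun t => C.PK s t ^ centry s t κ) C.nL) C.nL
/-- the class `ℓ¹` bound `Π_{s,t} ℓ¹(Ĥ_{st})^{M(s,t)}`. [cite: GathenGerhard2013ModernComputerAlgebra, Section 8.4] -/
def cl1 (κ : List (ℕ × ℕ × ℕ)) : ℕ := nprod (fun s => nprod (fun t => C.Habs s t ^ centry s t κ) C.nL) C.nL
/-- `Σ_{s,t} M(s,t)`. [cite: Polymath8b2014, Section 7.1] -/
def csum (κ : List (ℕ × ℕ × ℕ)) : ℕ := nsum (fun s => nsum (fun t => centry s t κ) C.nL) C.nL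
/-- row sum `Σ_t M(s,t)`. [cite: Polymath8b2014, Section 7.1] -/
def crow (κ : List (ℕ × ℕ × ℕ)) (s : ℕ) : ℕ := nsum (fun t => centry s t κ) C.nL
/-- column sum `Σ_s M(s,t)`. [cite: Polymath8b2014, Section 7.1] -/
def ccol (κ : List (ℕ × ℕ × ℕ)) (t : ℕ) : ℕ := nsum (fun s => centry s t κ) C.nL
/-- `n!/Π_s m_s!` (number of admissible assignments). [cite: Polymath8b2014, Section 7.1] -/
def mnom (n : ℕ) (m : ℕ → ℕ) : ℕ := n.factorial / nprod (fun s => (m s).factorial) C.nL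
/-- two listed classes agree entrywise. [cite: Polymath8b2014, Section 7.1] -/
def csame (κ κ' : List (ℕ × ℕ × ℕ)) : Bool :=
  nall (fun s => nall (fun t => centry s t κ == centry s t κ') C.nL) C.nL
/-- VERIFICATION of a supplied class list for an `n`-slot pair with signatures `m₁`, `m₂`: signatures sum to `n`;
every class has total `n`, row sums `m₁`, column sums `m₂`; the classes are pairwise distinct; and the mass identity
`Σ n!/Π M! = #adm(m₁) · #adm(m₂)` holds (so the list is complete, `jointClasses_eq_of_sum_multinomial_eq`).
[cite: Polymath8b2014, Section 7.1] -/
def validCL (n : ℕ) (m₁ m₂ : ℕ → ℕ) (CL : List (List (ℕ × ℕ × ℕ))) : Bool :=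
  (nsum m₁ C.nL == n) && (nsum m₂ C.nL == n) &&
  nall (fun i => (C.csum (CL.getD i []) == n) &&
    nall (fun s => (C.crow (CL.getD i []) s == m₁ s) && (C.ccol (CL.getD i []) s == m₂ s)) C.nL) CL.length &&
  nall (fun i => nall (fun j => Nat.ble i j || !(C.csame (CL.getD i []) (CL.getD j []))) CL.length) CL.length &&
  (nsum (fun i => C.cmult n (CL.getD i [])) CL.length == C.mnom n m₁ * C.mnom n m₂)
/-- the pair pack `P = Σ_κ (n!/Π M!) · Π Ĥ_{st}(2^B)^{M(s,t)}` (`= N(2^B)` for the integer class polynomial `N`).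
[cite: Polymath8b2014, Section 7.1] -/
def Pcl (n : ℕ) (CL : List (List (ℕ × ℕ × ℕ))) : ℤ :=
  zsum (fun i => (C.cmult n (CL.getD i []) : ℤ) * C.cpk (CL.getD i [])) CL.length
/-- the `ℓ¹` bound of the pair: `Σ_κ (n!/Π M!) Π ℓ¹(Ĥ_{st})^{M(s,t)}`. [cite: GathenGerhard2013ModernComputerAlgebra, Section 8.4] -/
def bndcl (n : ℕ) (CL : List (List (ℕ × ℕ × ℕ))) : ℕ :=
  nsum (fun i => C.cmult n (CL.getD i []) * C.cl1 (CL.getD i [])) CL.length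
/-- the digit offset `Ω = Σ_{j<Md} 2^H 2^{Bj}`. [cite: GathenGerhard2013ModernComputerAlgebra, Section 8.4] -/
def omg (Md : ℕ) : ℕ := nsum (fun j => pow2 (C.H + C.B * j)) Md
/-- the signed digits `R_m = digit_m(P + Ω) − 2^H` of an integer pack `P = R(2^B)`.
[cite: GathenGerhard2013ModernComputerAlgebra, Section 8.4] -/
def dZP (P : ℤ) (Md : ℕ) : ℕ → ℤ := fun N => (dg C.B (P + (C.omg Md : ℕ)).toNat N : ℤ) - (pow2 C.H : ℕ)
/-- the signed pack of a radial weight sequence `w_0, …, w_{Bc−1}`. [cite: GathenGerhard2013ModernComputerAlgebra, Section 8.4] -/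
def wpk (w : ℕ → ℤ) (Bc : ℕ) : ℤ := zsum (fun c => w c * (pow2 (C.B * c) : ℕ)) Bc
/-- `Σ_c |w_c|`. [cite: GathenGerhard2013ModernComputerAlgebra, Section 8.4] -/
def wabs (w : ℕ → ℤ) (Bc : ℕ) : ℕ := nsum (fun c => (w c).natAbs) Bc

/-! ### The `I`-side per generator pair -/

/-- number of digit slots, `I`-side. [cite: Polymath8b2014, Lemma 4.4] -/
def MdI : ℕ := C.L (C.k + 1) + 2 * C.A + 1
/-- the supplied classes of the generator pair `(x, y)`. [cite: Polymath8b2014, Section 7.1] -/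
def clsIf (x y : ℕ) : List (List (ℕ × ℕ × ℕ)) := C.clsI.getD (x * C.G + y) []
/-- `(Q_x Q_y)_t`. [cite: Polymath8b2014, Theorem 3.13, eq. (35)] -/
def QQ (x y t : ℕ) : ℤ := zsum (fun i => C.q x i * C.q y (t - i)) (t + 1)
/-- the `I`-side radial weights `ũ_t = (Q_xQ_y)_t · t!` (so that `Σ_t (Q_xQ_y)_t Λ_{n,t,ρ}(E) = Λ_{n,0,ρ}(E · Σ_t ũ_t X^t)`:
ONE Horner pass per pair). [cite: Polymath8b2014, Lemma 7.2] -/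
def UI (x y t : ℕ) : ℤ := C.QQ x y t * t.factorial
/-- validity of the pair `(x, y)`: classes and the no-carry bound `ℓ¹(N)·ℓ¹(ũ) < 2^H`. [cite: Polymath8b2014, Section 7.1] -/
def validI (x y : ℕ) : Bool :=
  C.validCL (C.k + 1) (C.sgc x) (C.sgc y) (C.clsIf x y) &&
    Nat.blt (C.bndcl (C.k + 1) (C.clsIf x y) * wabs (C.UI x y) (2 * C.A + 1)) (pow2 C.H)
/-- the signed digits of the pair polynomial `N · ũ`, `I`-side. [cite: Polymath8b2014, Lemma 4.4] -/
def dZI (x y : ℕ) : ℕ → ℤ := C.dZP (C.Pcl (C.k + 1) (C.clsIf x y) * C.wpk (C.UI x y) (2 * C.A + 1)) C.MdI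
/-- `I`-numerator of the pair `(x, y)`: `(ed+en)^{k+1} · Horner`. [cite: Polymath8b2014, Theorem 3.13, eq. (35)] -/
def IP (x y : ℕ) : ℤ :=
  (((C.ed + C.en) ^ (C.k + 1) : ℕ) : ℤ) * ZvalZ (C.dZI x y) (C.ed + C.en) C.ed (C.k + 1) C.MdI
/-- THE PER-PAIR KERNEL FACT, `I`-side: the pair is valid and its numerator is `v`. [cite: Polymath8b2014, Theorem 3.13, eq. (35)] -/
def okI (x y : ℕ) (v : ℤ) : Bool := C.validI x y && (C.IP x y == v)

/-! ### The `J`-side per signature pair -/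

/-- integer Beta weight `u! j! (A+S+1)!/(u+j+1)!`. [cite: Polymath8b2014, Lemma 4.4] -/
def bw (u j : ℕ) : ℕ := u.factorial * j.factorial * ((C.A + C.S + 1).factorial / (u + j + 1).factorial)
/-- `2^T (A+S+1)! · [X^N] T_{φ_s} Q_x`. [cite: Polymath8b2014, Lemma 4.4] -/
def Vint (x s N : ℕ) : ℤ :=
  zsum (fun u => zsum (fun j =>
    if u + j + 1 = N then C.q x u * C.a s j * (C.bw u j : ℤ) else 0) (C.S + 1)) (C.A + 1)
/-- the aggregated table entry `Σ_{(x,s) ↦ a} Vint x s N` (pointed generators with signature number `a`).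
[cite: Polymath8b2014, Section 7.2] -/
def WV (a N : ℕ) : ℤ :=
  zsum (fun x => zsum (fun s => if 1 ≤ C.sgc x s ∧ C.jxf x s = a then C.Vint x s N else 0) C.nL) C.G
/-- table lookup `wv[a][N]` (zero beyond `A+S+1`). [cite: Polymath8b2014, Section 7.2] -/
def wvq (a N : ℕ) : ℤ := if N ≤ C.A + C.S + 1 then (C.wv.getD a []).getD N 0 else 0
/-- VERIFICATION of the supplied convolution table. [cite: Polymath8b2014, Section 7.2] -/
def validW : Bool := nall (fun a => nall (fun N => C.wvq a N == C.WV a N) (C.A + C.S + 2)) C.NJ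
/-- VERIFICATION of the pointing map: for every pointed generator `(x, s)`, `jx x s < NJ` and
`sigJ[jx x s] = sg x − e_s`. [cite: Polymath8b2014, Section 7.2] -/
def validJx : Bool :=
  nall (fun x => nall (fun s => Nat.ble (C.sgc x s) 0 ||
    (Nat.blt (C.jxf x s) C.NJ &&
      nall (fun u => C.sgJc (C.jxf x s) u == (if u = s then C.sgc x u - 1 else C.sgc x u)) C.nL)) C.nL) C.G
/-- `(W_a W_b)_N` scaled. [cite: Polymath8b2014, Lemma 4.4] -/
def VV (a b N : ℕ) : ℤ := zsum (fun j => C.wvq a j * C.wvq b (N - j)) (N + 1)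
/-- scaled shifted coefficient `[(W_a W_b)(X + 2ε)]_c · DU · ed^Cmax`. [cite: Polymath8b2014, Lemma 4.4] -/
def Uint (a b c : ℕ) : ℤ :=
  zsum (fun N => C.VV a b N * ((N.choose c * (2 * C.en) ^ (N - c) * C.ed ^ (C.Cmax - (N - c)) : ℕ) : ℤ))
    (C.Cmax + 1)
/-- number of digit slots, `J`-side. [cite: Polymath8b2014, Lemma 4.4] -/
def MdJ : ℕ := C.L C.k + C.Cmax + 1
/-- the supplied classes of the signature pair `(a, b)`. [cite: Polymath8b2014, Section 7.1] -/
def clsJf (a b : ℕ) : List (List (ℕ × ℕ × ℕ)) := C.clsJ.getD (a * C.NJ + b) []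
/-- the `J`-side radial weights `ũ_c = Uint_c · c!`. [cite: Polymath8b2014, Lemma 7.2] -/
def UJ (a b c : ℕ) : ℤ := C.Uint a b c * c.factorial
/-- validity of the signature pair `(a, b)`. [cite: Polymath8b2014, Section 7.1] -/
def validJ (a b : ℕ) : Bool :=
  C.validCL C.k (C.sgJc a) (C.sgJc b) (C.clsJf a b) &&
    Nat.blt (C.bndcl C.k (C.clsJf a b) * wabs (C.UJ a b) (C.Cmax + 1)) (pow2 C.H)
/-- the signed digits of the pair polynomial `N · ũ`, `J`-side. [cite: Polymath8b2014, Lemma 4.4] -/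
def dZJ (a b : ℕ) : ℕ → ℤ := C.dZP (C.Pcl C.k (C.clsJf a b) * C.wpk (C.UJ a b) (C.Cmax + 1)) C.MdJ
/-- `J`-numerator of the signature pair `(a, b)`: `(ed−en)^k · Horner`. [cite: Polymath8b2014, Theorem 3.13, eq. (35)] -/
def JP (a b : ℕ) : ℤ :=
  (((C.ed - C.en) ^ C.k : ℕ) : ℤ) * ZvalZ (C.dZJ a b) (C.ed - C.en) C.ed C.k C.MdJ
/-- THE PER-PAIR KERNEL FACT, `J`-side. [cite: Polymath8b2014, Theorem 3.13, eq. (35)] -/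
def okJ (a b : ℕ) (v : ℤ) : Bool := C.validJ a b && (C.JP a b == v)

/-! ### Denominators and the global check -/

/-- `I`-denominator. [cite: Polymath8b2014, Theorem 3.13, eq. (35)] -/
def DenI : ℕ :=
  pow2 C.T ^ (2 * (C.k + 1)) * C.ed ^ (C.L (C.k + 1) + 2 * C.A + (C.k + 1)) *
    (C.L (C.k + 1) + 2 * C.A + (C.k + 1)).factorial
/-- scale of `W_a W_b`. [cite: Polymath8b2014, Lemma 4.4] -/
def DU : ℕ := (C.A + C.S + 1).factorial ^ 2 * pow2 C.T ^ 2
/-- `J`-denominator. [cite: Polymath8b2014, Theorem 3.13, eq. (35)] -/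
def DenJ : ℕ :=
  C.DU * C.ed ^ C.Cmax * pow2 C.T ^ (2 * C.k) * C.ed ^ (C.L C.k + C.Cmax + C.k) * (C.L C.k + C.Cmax + C.k).factorial
/-- a symmetric table read through its lower triangle. [cite: Polymath8b2014, Theorem 3.13, eq. (35)] -/
def symT (tb : ℕ → ℕ → ℤ) (x y : ℕ) : ℤ := if y ≤ x then tb x y else tb y x
/-- THE GLOBAL CHECK (tabulated form): `0 < en < ed`, the pointing map and the convolution table are valid, and with the
per-pair numerators read from the tables `tI` (generator pairs, lower triangle) and `tJ` (signature pairs, lower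
triangle): `0 < I` and `4·I·DenJ < (k+1)·J·DenI`. [cite: Polymath8b2014, Theorem 3.13, eq. (35)] -/
def checkTab (C : SymLCert) (tI tJ : ℕ → ℕ → ℤ) : Bool :=
  Nat.blt 0 C.en && Nat.blt C.en C.ed && C.validJx && C.validW &&
    decide (0 < zsum (fun x => zsum (fun y => symT tI x y) C.G) C.G) &&
    decide (4 * zsum (fun x => zsum (fun y => symT tI x y) C.G) C.G * (C.DenJ : ℤ) <
      ((C.k + 1 : ℕ) : ℤ) * zsum (fun a => zsum (fun b => symT tJ a b) C.NJ) C.NJ * (C.DenI : ℤ))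

end Program

end SymLCert

/-! ## Part B — specifications of the program pieces -/

section StructuralSpec

open ProdCert (nsum_eq zsum_eq nall_iff)

/-- the structural product is the `Finset.range` product. [cite: Polymath8b2014, Theorem 3.13, eq. (35)] -/
theorem nprod_eq (f : ℕ → ℕ) (n : ℕ) : nprod f n = ∏ i ∈ Finset.range n, f i := by
  induction n with
  | zero => rfl
  | succ n ih => rw [nprod, ih, Finset.prod_range_succ]

/-- the structural product is the `Finset.range` product. [cite: Polymath8b2014, Theorem 3.13, eq. (35)] -/
theorem zprod_eq (f : ℕ → ℤ) (n : ℕ) : zprod f n = ∏ i ∈ Finset.range n, f i := by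
  induction n with
  | zero => rfl
  | succ n ih => rw [zprod, ih, Finset.prod_range_succ]

/-- a double structural sum over `n × n` is a sum over `Fin n × Fin n`. [folklore] -/
private theorem nsum₂_eq (f : ℕ → ℕ → ℕ) (n : ℕ) :
    nsum (fun s => nsum (fun t => f s t) n) n = ∑ p : Fin n × Fin n, f p.1 p.2 := by
  rw [Fintype.sum_prod_type, nsum_eq, Finset.sum_range]
  exact Finset.sum_congr rfl fun s _ => by rw [nsum_eq, Finset.sum_range]

/-- a double structural product over `n × n` is a product over `Fin n × Fin n`. [folklore] -/
private theorem nprod₂_eq (f : ℕ → ℕ → ℕ) (n : ℕ) :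
    nprod (fun s => nprod (fun t => f s t) n) n = ∏ p : Fin n × Fin n, f p.1 p.2 := by
  rw [Fintype.prod_prod_type, nprod_eq, Finset.prod_range]
  exact Finset.prod_congr rfl fun s _ => by rw [nprod_eq, Finset.prod_range]

/-- a double structural product over `n × n` is a product over `Fin n × Fin n`. [folklore] -/
private theorem zprod₂_eq (f : ℕ → ℕ → ℤ) (n : ℕ) :
    zprod (fun s => zprod (fun t => f s t) n) n = ∏ p : Fin n × Fin n, f p.1 p.2 := by
  rw [Fintype.prod_prod_type, zprod_eq, Finset.prod_range]
  exact Finset.prod_congr rfl fun s _ => by rw [zprod_eq, Finset.prod_range]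

/-- `ℓ¹` of a product of powers. [folklore] -/
private theorem l1norm_prod_pow_le {α : Type*} [DecidableEq α] (s : Finset α) (P : α → ℤ[X]) (e : α → ℕ) :
    Literature.Analysis.Convolution.l1norm (∏ i ∈ s, P i ^ e i) ≤
      ∏ i ∈ s, Literature.Analysis.Convolution.l1norm (P i) ^ e i := by
  induction s using Finset.induction_on with
  | empty => simp [Literature.Analysis.Convolution.l1norm_one]
  | insert a s ha ih =>
    rw [Finset.prod_insert ha, Finset.prod_insert ha]
    refine (Literature.Analysis.Convolution.l1norm_mul_le _ _).trans ?_
    refine mul_le_mul (Literature.Analysis.Convolution.l1norm_pow_le _ _) ih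
      (Literature.Analysis.Convolution.l1norm_nonneg _) ?_
    exact pow_nonneg (Literature.Analysis.Convolution.l1norm_nonneg _) _

/-- Regrouping a double sum over pointed generators by signature number: if `g a b` is additive in its polynomial
argument, `Σ_u Σ_w g (j u) (j w) (V_u V_w) = Σ_a Σ_b g a b (W_a W_b)` with `W_a = Σ_{j u = a} V_u`. [folklore] -/
private theorem regroup_lemma {σ : Type*} [DecidableEq σ] (PG : Finset σ) (jf : σ → ℕ) (V : σ → ℝ[X]) (NJ : ℕ)
    (hj : ∀ u ∈ PG, jf u < NJ) (g : ℕ → ℕ → ℝ[X] → ℝ)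
    (hadd : ∀ a b U U', g a b (U + U') = g a b U + g a b U') (h0 : ∀ a b, g a b 0 = 0) :
    ∑ u ∈ PG, ∑ w ∈ PG, g (jf u) (jf w) (V u * V w) =
      ∑ a ∈ Finset.range NJ, ∑ b ∈ Finset.range NJ,
        g a b ((∑ u ∈ PG, if jf u = a then V u else 0) * ∑ w ∈ PG, if jf w = b then V w else 0) := by
  have hsum : ∀ a b (t : Finset σ) (U : σ → ℝ[X]), g a b (∑ u ∈ t, U u) = ∑ u ∈ t, g a b (U u) := by
    intro a b t U
    induction t using Finset.induction_on with
    | empty => simp [h0]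
    | insert x t hx ih => rw [Finset.sum_insert hx, Finset.sum_insert hx, hadd, ih]
  have hite : ∀ a b (P : Prop) [Decidable P] (U : ℝ[X]), g a b (if P then U else 0) = if P then g a b U else 0 := by
    intro a b P _ U; split_ifs <;> simp [h0]
  symm
  calc ∑ a ∈ Finset.range NJ, ∑ b ∈ Finset.range NJ,
        g a b ((∑ u ∈ PG, if jf u = a then V u else 0) * ∑ w ∈ PG, if jf w = b then V w else 0)
      = ∑ a ∈ Finset.range NJ, ∑ b ∈ Finset.range NJ, ∑ u ∈ PG, ∑ w ∈ PG,
          if jf u = a then (if jf w = b then g a b (V u * V w) else 0) else 0 := by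
        refine Finset.sum_congr rfl fun a _ => Finset.sum_congr rfl fun b _ => ?_
        rw [Finset.sum_mul_sum, hsum]
        refine Finset.sum_congr rfl fun u _ => ?_
        rw [hsum]
        refine Finset.sum_congr rfl fun w _ => ?_
        rw [ite_zero_mul_ite_zero, hite, ite_and]
    _ = ∑ u ∈ PG, ∑ w ∈ PG, ∑ a ∈ Finset.range NJ, ∑ b ∈ Finset.range NJ,
          if jf u = a then (if jf w = b then g a b (V u * V w) else 0) else 0 := by
        simp only [Finset.sum_comm (s := Finset.range NJ) (t := PG)]
    _ = ∑ u ∈ PG, ∑ w ∈ PG, g (jf u) (jf w) (V u * V w) := by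
        refine Finset.sum_congr rfl fun u hu => Finset.sum_congr rfl fun w hw => ?_
        rw [Finset.sum_comm, Finset.sum_congr rfl fun b _ => by
          rw [Finset.sum_ite_eq, if_pos (Finset.mem_range.2 (hj u hu))],
          Finset.sum_ite_eq, if_pos (Finset.mem_range.2 (hj w hw))]

end StructuralSpec

namespace SymLCert

variable (C : SymLCert)

section Spec

open ProdCert (nsum_eq zsum_eq nall_iff pall pall_iff pow2_eq dg_eq_kdigit)
open Literature.Analysis.Convolution (l1norm koffset kpack kdigit)

/-! ### Polynomial models of profiles, radial polynomials and the pair polynomials -/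

/-- `Φ_{s,j} = 0` beyond `S`. [cite: Polymath8b2014, Theorem 3.13, eq. (35)] -/
theorem a_eq_zero {s j : ℕ} (h : C.S < j) : C.a s j = 0 := by
  rw [a, if_neg (by omega)]

/-- `Q_x[i] = 0` beyond `A` (internal; same computation as `ProdCert.q_eq_zero` for this structure). [folklore] -/
private theorem q_eq_zero {x i : ℕ} (h : C.A < i) : C.q x i = 0 := by
  rw [q, if_neg (by omega)]

/-- `wv[a][N] = 0` beyond `A+S+1`. [cite: Polymath8b2014, Theorem 3.13, eq. (35)] -/
theorem wvq_eq_zero {a N : ℕ} (h : C.A + C.S + 1 < N) : C.wvq a N = 0 := by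
  rw [wvq, if_neg (by omega)]

/-- the integer profile `Φ_s = Σ_j Φ_{s,j} X^j`. [cite: Polymath8b2014, Lemma 4.4] -/
noncomputable def aZ (s : ℕ) : ℤ[X] := ∑ j ∈ Finset.range (C.S + 1), Polynomial.monomial j (C.a s j)
/-- the profile `φ_s = 2^{-T} Φ_s`. [cite: Polymath8b2014, Lemma 4.4] -/
noncomputable def phR (s : ℕ) : ℝ[X] :=
  ∑ j ∈ Finset.range (C.S + 1), Polynomial.monomial j ((C.a s j : ℝ) / 2 ^ C.T)
/-- the radial polynomial `Q_x`. [cite: Polymath8b2014, Theorem 3.13, eq. (35)] -/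
noncomputable def QR (x : ℕ) : ℝ[X] :=
  ∑ i ∈ Finset.range (C.A + 1), Polynomial.monomial i ((C.q x i : ℤ) : ℝ)
/-- the integer pair polynomial `Ĥ_{st} = Σ_m Ĥ_{st,m} X^m`. [cite: Polymath8b2014, Lemma 4.4] -/
noncomputable def HZ (s t : ℕ) : ℤ[X] := ∑ m ∈ Finset.range C.M, Polynomial.monomial m (C.Hc s t m)

/-- coefficients of `Φ_s`. [cite: Polymath8b2014, Lemma 4.4] -/
theorem coeff_aZ (s j : ℕ) : (C.aZ s).coeff j = C.a s j := by
  rw [aZ, Polynomial.finsetSum_coeff]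
  simp only [Polynomial.coeff_monomial, Finset.sum_ite_eq', Finset.mem_range]
  split_ifs with h
  · rfl
  · exact (C.a_eq_zero (by omega)).symm

/-- coefficients of `φ_s`. [cite: Polymath8b2014, Lemma 4.4] -/
theorem coeff_phR (s j : ℕ) : (C.phR s).coeff j = (C.a s j : ℝ) / 2 ^ C.T := by
  rw [phR, Polynomial.finsetSum_coeff]
  simp only [Polynomial.coeff_monomial, Finset.sum_ite_eq', Finset.mem_range]
  split_ifs with h
  · rfl
  · rw [C.a_eq_zero (by omega)]; simp

/-- coefficients of `Q_x` (internal; as `ProdCert.coeff_QR`). [folklore] -/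
private theorem coeff_QR (x i : ℕ) : (C.QR x).coeff i = ((C.q x i : ℤ) : ℝ) := by
  rw [QR, Polynomial.finsetSum_coeff]
  simp only [Polynomial.coeff_monomial, Finset.sum_ite_eq', Finset.mem_range]
  split_ifs with h
  · rfl
  · rw [C.q_eq_zero (by omega)]; simp

/-- coefficients of `Ĥ_{st}`. [cite: Polymath8b2014, Lemma 4.4] -/
theorem coeff_HZ (s t m : ℕ) : (C.HZ s t).coeff m = if m < C.M then C.Hc s t m else 0 := by
  rw [HZ, Polynomial.finsetSum_coeff]
  simp only [Polynomial.coeff_monomial, Finset.sum_ite_eq', Finset.mem_range]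

/-- `deg Φ_s ≤ S`. [cite: Polymath8b2014, Lemma 4.4] -/
theorem natDegree_aZ_le (s : ℕ) : (C.aZ s).natDegree ≤ C.S :=
  Polynomial.natDegree_sum_le_of_forall_le _ _ fun _ hs =>
    (Polynomial.natDegree_monomial_le _).trans (Nat.lt_succ_iff.1 (Finset.mem_range.1 hs))

/-- `deg φ_s ≤ S`. [cite: Polymath8b2014, Lemma 4.4] -/
theorem natDegree_phR_le (s : ℕ) : (C.phR s).natDegree ≤ C.S :=
  Polynomial.natDegree_sum_le_of_forall_le _ _ fun _ hs =>
    (Polynomial.natDegree_monomial_le _).trans (Nat.lt_succ_iff.1 (Finset.mem_range.1 hs))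

/-- `deg Q_x ≤ A` (internal; as `ProdCert.natDegree_QR_le`). [folklore] -/
private theorem natDegree_QR_le (x : ℕ) : (C.QR x).natDegree ≤ C.A :=
  Polynomial.natDegree_sum_le_of_forall_le _ _ fun _ hs =>
    (Polynomial.natDegree_monomial_le _).trans (Nat.lt_succ_iff.1 (Finset.mem_range.1 hs))

/-- `deg Ĥ_{st} ≤ 2S`. [cite: Polymath8b2014, Lemma 4.4] -/
theorem natDegree_HZ_le (s t : ℕ) : (C.HZ s t).natDegree ≤ 2 * C.S :=
  Polynomial.natDegree_sum_le_of_forall_le _ _ fun _ hs =>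
    (Polynomial.natDegree_monomial_le _).trans (by have := Finset.mem_range.1 hs; rw [M] at this; omega)

/-- `Ĥ_{st,m} = m! (Φ_s Φ_t)_m`. [cite: Polymath8b2014, Lemma 4.4] -/
theorem Hc_eq (s t m : ℕ) : C.Hc s t m = m.factorial * (C.aZ s * C.aZ t).coeff m := by
  rw [Hc, zsum_eq, Polynomial.coeff_mul, Finset.Nat.sum_antidiagonal_eq_sum_range_succ_mk]
  simp only [coeff_aZ]

/-- `(Ĥ_{st})_m = m! (Φ_s Φ_t)_m` for all `m`. [cite: Polymath8b2014, Lemma 4.4] -/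
theorem coeff_HZ_eq (s t m : ℕ) : (C.HZ s t).coeff m = m.factorial * (C.aZ s * C.aZ t).coeff m := by
  rw [coeff_HZ]
  split_ifs with h
  · exact C.Hc_eq s t m
  · rw [Polynomial.coeff_eq_zero_of_natDegree_lt (p := C.aZ s * C.aZ t)]
    · simp
    · refine lt_of_le_of_lt Polynomial.natDegree_mul_le ?_
      have := C.natDegree_aZ_le s; have := C.natDegree_aZ_le t; rw [M] at h; omega

/-- **`hat(φ_s φ_t) = 2^{-2T} · Ĥ_{st}`** (as real polynomials). [cite: Polymath8b2014, Lemma 7.2] -/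
theorem hat_phR (s t : ℕ) :
    hat (C.phR s * C.phR t) = Polynomial.C (1 / ((2 : ℝ) ^ C.T) ^ 2) * (C.HZ s t).map (Int.castRingHom ℝ) := by
  ext m
  rw [coeff_hat, Polynomial.coeff_C_mul, Polynomial.coeff_map, coeff_HZ_eq, Polynomial.coeff_mul,
    Polynomial.coeff_mul]
  simp only [coeff_phR, coeff_aZ, eq_intCast, Int.cast_mul, Int.cast_natCast, Int.cast_sum, Finset.sum_mul,
    Finset.mul_sum]
  refine Finset.sum_congr rfl fun x _ => ?_
  have h2 : (2 : ℝ) ^ C.T ≠ 0 := by positivity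
  field_simp

/-- the signed pack is `Ĥ_{st}(2^B)`. [cite: GathenGerhard2013ModernComputerAlgebra, Section 8.4] -/
theorem PK_eq (s t : ℕ) : C.PK s t = (C.HZ s t).eval ((2 : ℤ) ^ C.B) := by
  rw [PK, zsum_eq, HZ, Polynomial.eval_finsetSum]
  refine Finset.sum_congr rfl fun m _ => ?_
  rw [Polynomial.eval_monomial, pow2_eq, Nat.cast_pow, pow_mul]
  rfl

/-- `Habs = ℓ¹(Ĥ_{st})`. [cite: GathenGerhard2013ModernComputerAlgebra, Section 8.4] -/
theorem Habs_eq (s t : ℕ) : (C.Habs s t : ℤ) = l1norm (C.HZ s t) := by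
  rw [Literature.Analysis.Convolution.l1norm_eq_sum_range _
      (Nat.lt_of_le_of_lt (C.natDegree_HZ_le s t) (by rw [M]; omega) : (C.HZ s t).natDegree < C.M),
    Habs, nsum_eq, Nat.cast_sum]
  refine Finset.sum_congr rfl fun m hm => ?_
  rw [coeff_HZ, if_pos (Finset.mem_range.1 hm), Int.natCast_natAbs]

/-! ### Classes -/

/-- a listed class as a joint multiplicity matrix on `Fin nL × Fin nL`. [cite: Polymath8b2014, Section 7.1] -/
def cfun (κ : List (ℕ × ℕ × ℕ)) : Fin C.nL × Fin C.nL → ℕ := fun p => centry p.1 p.2 κ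

/-- `cfact = Π M(p)!`. [cite: Polymath8b2014, Section 7.1] -/
theorem cfact_eq (κ : List (ℕ × ℕ × ℕ)) : C.cfact κ = ∏ p : Fin C.nL × Fin C.nL, (C.cfun κ p).factorial :=
  nprod₂_eq _ _

/-- `csum = Σ M(p)`. [cite: Polymath8b2014, Section 7.1] -/
theorem csum_eq (κ : List (ℕ × ℕ × ℕ)) : C.csum κ = ∑ p : Fin C.nL × Fin C.nL, C.cfun κ p :=
  nsum₂_eq _ _

/-- `crow s = Σ_t M(s,t)`. [cite: Polymath8b2014, Section 7.1] -/
theorem crow_eq (κ : List (ℕ × ℕ × ℕ)) (s : Fin C.nL) : C.crow κ s = ∑ t : Fin C.nL, C.cfun κ (s, t) := by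
  rw [crow, nsum_eq, Finset.sum_range]
  rfl

/-- `ccol t = Σ_s M(s,t)`. [cite: Polymath8b2014, Section 7.1] -/
theorem ccol_eq (κ : List (ℕ × ℕ × ℕ)) (t : Fin C.nL) : C.ccol κ t = ∑ s : Fin C.nL, C.cfun κ (s, t) := by
  rw [ccol, nsum_eq, Finset.sum_range]
  rfl

/-- `cmult = n!/Π M! = Nat.multinomial`. [cite: Polymath8b2014, Section 7.1] -/
theorem cmult_eq {n : ℕ} {κ : List (ℕ × ℕ × ℕ)} (h : ∑ p, C.cfun κ p = n) :
    C.cmult n κ = Nat.multinomial Finset.univ (C.cfun κ) := by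
  rw [cmult, Nat.multinomial, h, cfact_eq]

/-- the class pack is the product of the pair packs. [cite: GathenGerhard2013ModernComputerAlgebra, Section 8.4] -/
theorem cpk_eq (κ : List (ℕ × ℕ × ℕ)) :
    C.cpk κ = ∏ p : Fin C.nL × Fin C.nL, (C.HZ p.1 p.2).eval ((2 : ℤ) ^ C.B) ^ C.cfun κ p := by
  rw [cpk, zprod₂_eq]
  simp only [PK_eq]
  rfl

/-- the class `ℓ¹` bound is the product of the pair bounds. [cite: GathenGerhard2013ModernComputerAlgebra, Section 8.4] -/
theorem cl1_eq (κ : List (ℕ × ℕ × ℕ)) :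
    (C.cl1 κ : ℤ) = ∏ p : Fin C.nL × Fin C.nL, l1norm (C.HZ p.1 p.2) ^ C.cfun κ p := by
  rw [cl1, nprod₂_eq, Nat.cast_prod]
  simp only [Nat.cast_pow, Habs_eq]
  rfl

/-- `mnom n m = n!/Π m_s! = Nat.multinomial`. [cite: Polymath8b2014, Section 7.1] -/
theorem mnom_eq {n : ℕ} {m : ℕ → ℕ} (h : ∑ s : Fin C.nL, m s = n) :
    C.mnom n m = Nat.multinomial Finset.univ (fun s : Fin C.nL => m s) := by
  rw [mnom, Nat.multinomial, h, nprod_eq, Finset.prod_range]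

/-- `csame` decides equality of the matrices. [cite: Polymath8b2014, Section 7.1] -/
theorem csame_iff (κ κ' : List (ℕ × ℕ × ℕ)) : C.csame κ κ' = true ↔ C.cfun κ = C.cfun κ' := by
  rw [csame, nall_iff]
  constructor
  · intro h
    funext p
    have := (nall_iff _ _).1 (h p.1 p.1.isLt) p.2 p.2.isLt
    simpa [cfun] using this
  · intro h s hs
    rw [nall_iff]
    intro t ht
    have := congrFun h (⟨s, hs⟩, ⟨t, ht⟩)
    simpa [cfun] using this

/-- **Soundness of the class-list verification**: the signatures sum to `n`, every listed class has total `n`, the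
listing is injective, and its image IS `jointClasses n m₁ m₂`. [cite: Polymath8b2014, Section 7.1] -/
theorem validCL_sound {n : ℕ} {m₁ m₂ : ℕ → ℕ} {CL : List (List (ℕ × ℕ × ℕ))}
    (h : C.validCL n m₁ m₂ CL = true) :
    (∑ s : Fin C.nL, m₁ s = n) ∧ (∑ s : Fin C.nL, m₂ s = n) ∧
    (∀ i < CL.length, ∑ p, C.cfun (CL.getD i []) p = n) ∧
    Set.InjOn (fun i => C.cfun (CL.getD i [])) ↑(Finset.range CL.length) ∧
    (Finset.range CL.length).image (fun i => C.cfun (CL.getD i [])) =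
      jointClasses n (fun s : Fin C.nL => m₁ s) (fun s : Fin C.nL => m₂ s) := by
  simp only [validCL, Bool.and_eq_true, beq_iff_eq, nall_iff, Bool.or_eq_true, Nat.ble_eq,
    Bool.not_eq_true'] at h
  obtain ⟨⟨⟨⟨h1, h2⟩, hcls⟩, hdist⟩, hmass⟩ := h
  rw [nsum_eq, Finset.sum_range] at h1 h2
  have htot : ∀ i < CL.length, ∑ p, C.cfun (CL.getD i []) p = n := fun i hi => by
    rw [← csum_eq]; exact (hcls i hi).1
  have hinj : Set.InjOn (fun i => C.cfun (CL.getD i [])) ↑(Finset.range CL.length) := by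
    intro i hi j hj hij
    simp only [Finset.coe_range, Set.mem_Iio] at hi hj
    by_contra hne
    rcases Nat.lt_or_gt_of_ne hne with hlt | hlt
    · rcases hdist j hj i hi with hle | hns
      · omega
      · exact absurd ((C.csame_iff _ _).2 hij.symm) (by rw [hns]; exact Bool.false_ne_true)
    · rcases hdist i hi j hj with hle | hns
      · omega
      · exact absurd ((C.csame_iff _ _).2 hij) (by rw [hns]; exact Bool.false_ne_true)
  refine ⟨h1, h2, htot, hinj, jointClasses_eq_of_sum_multinomial_eq _ ?_ ?_⟩
  · intro M hM
    obtain ⟨i, hi, rfl⟩ := Finset.mem_image.1 hM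
    have hi' := Finset.mem_range.1 hi
    refine ⟨htot i hi', fun s => ?_, fun t => ?_⟩
    · rw [← crow_eq]; exact ((hcls i hi').2 s s.isLt).1
    · rw [← ccol_eq]; exact ((hcls i hi').2 t t.isLt).2
  · rw [Finset.sum_image hinj, card_ladmissible_eq_multinomial h1, card_ladmissible_eq_multinomial h2,
      ← C.mnom_eq h1, ← C.mnom_eq h2, ← hmass, nsum_eq]
    exact Finset.sum_congr rfl fun i hi => (C.cmult_eq (htot i (Finset.mem_range.1 hi))).symm

/-- `E_n(m₁, m₂)` summed over the VERIFIED class list. [cite: Polymath8b2014, Section 7.1] -/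
theorem EsumL_eq_sum_cls {n : ℕ} {m₁ m₂ : ℕ → ℕ} {CL : List (List (ℕ × ℕ × ℕ))}
    (h : C.validCL n m₁ m₂ CL = true) (φ : Fin C.nL → ℝ[X]) :
    EsumL φ n (fun s : Fin C.nL => m₁ s) (fun s : Fin C.nL => m₂ s) =
      ∑ i ∈ Finset.range CL.length, Nat.multinomial Finset.univ (C.cfun (CL.getD i [])) •
        ∏ p : Fin C.nL × Fin C.nL, hat (φ p.1 * φ p.2) ^ C.cfun (CL.getD i []) p := by
  obtain ⟨_, _, _, hinj, himg⟩ := C.validCL_sound h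
  rw [EsumL_eq_sum_jointClasses, ← himg, Finset.sum_image hinj]

/-! ### The integer class polynomial of a pair and its digits -/

/-- `N = Σ_κ (n!/Π M!) Π_{(s,t)} Ĥ_{st}^{M(s,t)} ∈ ℤ[X]` (`= 2^{2Tn} E_n(m₁,m₂)`). [cite: Polymath8b2014, Section 7.1] -/
noncomputable def NZ (n : ℕ) (CL : List (List (ℕ × ℕ × ℕ))) : ℤ[X] :=
  ∑ i ∈ Finset.range CL.length, Polynomial.C ((C.cmult n (CL.getD i []) : ℕ) : ℤ) *
    ∏ p : Fin C.nL × Fin C.nL, C.HZ p.1 p.2 ^ C.cfun (CL.getD i []) p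

/-- the pair pack is `N(2^B)`. [cite: GathenGerhard2013ModernComputerAlgebra, Section 8.4] -/
theorem Pcl_eq (n : ℕ) (CL : List (List (ℕ × ℕ × ℕ))) : C.Pcl n CL = (C.NZ n CL).eval ((2 : ℤ) ^ C.B) := by
  rw [Pcl, zsum_eq, NZ, Polynomial.eval_finsetSum]
  refine Finset.sum_congr rfl fun i _ => ?_
  rw [Polynomial.eval_mul, Polynomial.eval_C, Polynomial.eval_prod, cpk_eq]
  simp only [Polynomial.eval_pow]

/-- **`E_n(m₁,m₂) = 2^{-2Tn} · N`** for a verified class list. [cite: Polymath8b2014, Section 7.1] -/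
theorem EsumL_eq_NZ {n : ℕ} {m₁ m₂ : ℕ → ℕ} {CL : List (List (ℕ × ℕ × ℕ))}
    (h : C.validCL n m₁ m₂ CL = true) :
    EsumL (fun s : Fin C.nL => C.phR s) n (fun s : Fin C.nL => m₁ s) (fun s : Fin C.nL => m₂ s) =
      Polynomial.C ((1 / ((2 : ℝ) ^ C.T) ^ 2) ^ n) * (C.NZ n CL).map (Int.castRingHom ℝ) := by
  obtain ⟨_, _, htot, _, _⟩ := C.validCL_sound h
  rw [C.EsumL_eq_sum_cls h, NZ, Polynomial.map_sum, Finset.mul_sum]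
  refine Finset.sum_congr rfl fun i hi => ?_
  have hi' := Finset.mem_range.1 hi
  rw [Polynomial.map_mul, Polynomial.map_C, Polynomial.map_prod, C.cmult_eq (htot i hi'), nsmul_eq_mul]
  simp only [Polynomial.map_pow, hat_phR, eq_intCast, Int.cast_natCast]
  rw [Finset.prod_congr rfl (fun p _ => mul_pow _ _ _), Finset.prod_mul_distrib, Finset.prod_pow_eq_pow_sum,
    htot i hi', ← Polynomial.C_pow, ← Polynomial.C_eq_natCast]
  ring

/-- `deg N ≤ n·2S`. [cite: Polymath8b2014, Lemma 4.4] -/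
theorem natDegree_NZ_le {n : ℕ} {CL : List (List (ℕ × ℕ × ℕ))}
    (htot : ∀ i < CL.length, ∑ p, C.cfun (CL.getD i []) p = n) : (C.NZ n CL).natDegree ≤ C.L n := by
  refine Polynomial.natDegree_sum_le_of_forall_le _ _ fun i hi => ?_
  refine (Polynomial.natDegree_C_mul_le _ _).trans ((Polynomial.natDegree_prod_le _ _).trans ?_)
  calc ∑ p : Fin C.nL × Fin C.nL, (C.HZ p.1 p.2 ^ C.cfun (CL.getD i []) p).natDegree
      ≤ ∑ p : Fin C.nL × Fin C.nL, C.cfun (CL.getD i []) p * (2 * C.S) :=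
        Finset.sum_le_sum fun p _ =>
          Polynomial.natDegree_pow_le.trans (Nat.mul_le_mul_left _ (C.natDegree_HZ_le _ _))
    _ = C.L n := by rw [← Finset.sum_mul, htot i (Finset.mem_range.1 hi), L]

/-- `|N_K| ≤ bndcl` (no coefficient is computed: `ℓ¹` is submultiplicative). [cite: GathenGerhard2013ModernComputerAlgebra, Section 8.4] -/
theorem abs_coeff_NZ_le (n : ℕ) (CL : List (List (ℕ × ℕ × ℕ))) (K : ℕ) :
    |(C.NZ n CL).coeff K| ≤ (C.bndcl n CL : ℤ) := by
  rw [NZ, Polynomial.finsetSum_coeff, bndcl, nsum_eq, Nat.cast_sum]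
  refine (Finset.abs_sum_le_sum_abs _ _).trans (Finset.sum_le_sum fun i _ => ?_)
  rw [Polynomial.coeff_C_mul, abs_mul, Nat.cast_mul, cl1_eq, Nat.abs_cast]
  exact mul_le_mul_of_nonneg_left
    ((Literature.Analysis.Convolution.abs_coeff_le_l1norm _ _).trans (l1norm_prod_pow_le _ _ _))
    (Nat.cast_nonneg _)

/-- the program's offset is `Ω`. [cite: GathenGerhard2013ModernComputerAlgebra, Section 8.4] -/
theorem omg_eq (Md : ℕ) : C.omg Md = koffset C.B C.H Md := by
  rw [omg, nsum_eq, Literature.Analysis.Convolution.koffset, Literature.Analysis.Convolution.kpack]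
  refine Finset.sum_congr rfl fun j _ => ?_
  rw [pow2_eq, pow_add]

/-! ### Radial weights folded into the polynomial: ONE Dirichlet functional per pair -/

/-- the radial weight polynomial `ũ = Σ_{c<Bc} w_c X^c ∈ ℤ[X]`. [cite: Polymath8b2014, Lemma 7.2] -/
noncomputable def UZ (w : ℕ → ℤ) (Bc : ℕ) : ℤ[X] := ∑ c ∈ Finset.range Bc, Polynomial.monomial c (w c)

/-- coefficients of `ũ`. [cite: Polymath8b2014, Lemma 7.2] -/
theorem coeff_UZ (w : ℕ → ℤ) (Bc c : ℕ) : (UZ w Bc).coeff c = if c < Bc then w c else 0 := by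
  rw [UZ, Polynomial.finsetSum_coeff]
  simp only [Polynomial.coeff_monomial, Finset.sum_ite_eq', Finset.mem_range]

/-- `deg ũ ≤ B'` when `Bc = B'+1`. [cite: Polymath8b2014, Lemma 7.2] -/
theorem natDegree_UZ_le (w : ℕ → ℤ) (B' : ℕ) : (UZ w (B' + 1)).natDegree ≤ B' :=
  Polynomial.natDegree_sum_le_of_forall_le _ _ fun _ hc =>
    (Polynomial.natDegree_monomial_le _).trans (by have := Finset.mem_range.1 hc; omega)

/-- the weight pack is `ũ(2^B)`. [cite: GathenGerhard2013ModernComputerAlgebra, Section 8.4] -/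
theorem wpk_eq (w : ℕ → ℤ) (Bc : ℕ) : C.wpk w Bc = (UZ w Bc).eval ((2 : ℤ) ^ C.B) := by
  rw [wpk, zsum_eq, UZ, Polynomial.eval_finsetSum]
  refine Finset.sum_congr rfl fun c _ => ?_
  rw [Polynomial.eval_monomial, pow2_eq, Nat.cast_pow, pow_mul]
  rfl

/-- `wabs = Σ_c |w_c|`. [cite: GathenGerhard2013ModernComputerAlgebra, Section 8.4] -/
theorem wabs_eq (w : ℕ → ℤ) (Bc : ℕ) : (wabs w Bc : ℤ) = ∑ c ∈ Finset.range Bc, |w c| := by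
  rw [wabs, nsum_eq, Nat.cast_sum]
  exact Finset.sum_congr rfl fun c _ => Int.natCast_natAbs _

/-- **no coefficient of `N·ũ` is computed**: `|(N ũ)_m| ≤ bndcl · Σ|w_c|`. [cite: GathenGerhard2013ModernComputerAlgebra, Section 8.4] -/
theorem abs_coeff_NZ_mul_UZ_le (n : ℕ) (CL : List (List (ℕ × ℕ × ℕ))) (w : ℕ → ℤ) (Bc m : ℕ) :
    |(C.NZ n CL * UZ w Bc).coeff m| ≤ (C.bndcl n CL : ℤ) * (wabs w Bc : ℤ) := by
  rw [Polynomial.coeff_mul, wabs_eq]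
  refine (Finset.abs_sum_le_sum_abs _ _).trans ?_
  calc ∑ x ∈ Finset.HasAntidiagonal.antidiagonal m, |(C.NZ n CL).coeff x.1 * (UZ w Bc).coeff x.2|
      ≤ ∑ x ∈ Finset.HasAntidiagonal.antidiagonal m, (C.bndcl n CL : ℤ) * |(UZ w Bc).coeff x.2| :=
        Finset.sum_le_sum fun x _ => by
          rw [abs_mul]; exact mul_le_mul_of_nonneg_right (C.abs_coeff_NZ_le n CL _) (abs_nonneg _)
    _ = (C.bndcl n CL : ℤ) * ∑ j ∈ Finset.range (m + 1), |(UZ w Bc).coeff j| := by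
        rw [← Finset.mul_sum, Finset.Nat.sum_antidiagonal_eq_sum_range_succ (fun _ j => |(UZ w Bc).coeff j|)]
        congr 1
        conv_rhs => rw [← Finset.sum_range_reflect]
        exact Finset.sum_congr rfl fun j _ => by congr 2
    _ ≤ (C.bndcl n CL : ℤ) * ∑ c ∈ Finset.range Bc, |w c| := by
        refine mul_le_mul_of_nonneg_left ?_ (Nat.cast_nonneg _)
        have hsub : ∑ j ∈ Finset.range (m + 1), |(UZ w Bc).coeff j| =
            ∑ j ∈ (Finset.range (m + 1)).filter (fun j => j < Bc), |w j| := by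
          rw [Finset.sum_filter]
          refine Finset.sum_congr rfl fun j _ => ?_
          rw [coeff_UZ]; split_ifs <;> simp
        rw [hsub]
        refine Finset.sum_le_sum_of_subset_of_nonneg (fun j hj => ?_) (fun _ _ _ => abs_nonneg _)
        exact Finset.mem_range.2 (Finset.mem_filter.1 hj).2

/-- **The signed digits of the pack `P = R(2^B)` are the coefficients of `R`** (no carries: `|R_j| < 2^H`).
[cite: GathenGerhard2013ModernComputerAlgebra, Section 8.4] -/
theorem dZP_eq_coeff (R : ℤ[X]) {Md : ℕ} (hdeg : R.natDegree < Md) (hb : ∀ j, |R.coeff j| < 2 ^ C.H)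
    {m : ℕ} (hm : m < Md) : C.dZP (R.eval ((2 : ℤ) ^ C.B)) Md m = R.coeff m := by
  rw [Literature.Analysis.Convolution.coeff_eq_kdigit_sub R (B := C.B) (H := C.H) hdeg
      (fun j => (abs_lt.1 (hb j)).1.le) (fun j => by rw [B, pow_succ]; linarith [(abs_lt.1 (hb j)).2]) hm,
    dZP, dg_eq_kdigit, omg_eq, pow2_eq]
  push_cast
  rfl

/-- **Folding the radial weights into the polynomial**: `Σ_{c<Bc} u_c Λ_{n,c,r}(p) = Λ_{n,0,r}(p · Σ_c u_c c! X^c)`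
(`c!/(K+n+c)! · r^{K+n+c} = c! · Λ_{n,0,r}(X^{K+c})`). [cite: Polymath8b2014, Lemma 7.2] -/
theorem sum_mul_simplexFunctional (n : ℕ) (r : ℝ) (p : ℝ[X]) (u : ℕ → ℝ) (Bc : ℕ) :
    ∑ c ∈ Finset.range Bc, u c * simplexFunctional n c r p =
      simplexFunctional n 0 r (p * ∑ c ∈ Finset.range Bc, Polynomial.monomial c (u c * (c.factorial : ℝ))) := by
  rw [Finset.mul_sum, map_sum]
  refine Finset.sum_congr rfl fun c _ => ?_
  rw [simplexFunctional_mul n 0 r p _ (Nat.lt_succ_self _)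
      (Bq := c + 1) ((Polynomial.natDegree_monomial_le _).trans_lt (Nat.lt_succ_self c)),
    simplexFunctional_eq_sum_range n c r p (Nat.lt_succ_self _), Finset.mul_sum]
  refine Finset.sum_congr rfl fun K _ => ?_
  rw [Finset.sum_range_succ, Finset.sum_eq_zero (fun j hj => by
    rw [Polynomial.coeff_monomial, if_neg (by have := Finset.mem_range.1 hj; omega)]; simp), zero_add,
    Polynomial.coeff_monomial, if_pos rfl, simplexWeight, simplexWeight, Nat.factorial_zero, Nat.cast_one,
    show K + c + n + 0 = K + n + c by ring]
  have hf : ((K + n + c).factorial : ℝ) ≠ 0 := by positivity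
  field_simp

/-- **The pair value from ONE Horner pass**: for a verified class list and integer weights `w` with
`bndcl · Σ|w| < 2^H`, `Λ_{n,0,rn/rd}(E_n(m₁,m₂) · ũ) = rn^n · ZvalZ(dZP(P·ũ(2^B)))… / (2^{2Tn} rd^{L+B'+n} (L+B'+n)!)`.
[cite: Polymath8b2014, Lemma 4.4] -/
theorem pair_value {n : ℕ} {m₁ m₂ : ℕ → ℕ} {CL : List (List (ℕ × ℕ × ℕ))}
    (h : C.validCL n m₁ m₂ CL = true) (w : ℕ → ℤ) (B' : ℕ)
    (hb : C.bndcl n CL * wabs w (B' + 1) < 2 ^ C.H) (rn rd : ℕ) (hrd : 0 < rd) :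
    simplexFunctional n 0 ((rn : ℝ) / rd)
        (EsumL (fun s : Fin C.nL => C.phR s) n (fun s : Fin C.nL => m₁ s) (fun s : Fin C.nL => m₂ s) *
          (UZ w (B' + 1)).map (Int.castRingHom ℝ)) =
      (rn : ℝ) ^ n * (ZvalZ (C.dZP (C.Pcl n CL * C.wpk w (B' + 1)) (C.L n + B' + 1)) rn rd n (C.L n + B' + 1) : ℝ) /
        ((((2 : ℝ) ^ C.T) ^ 2) ^ n * (rd : ℝ) ^ (C.L n + B' + n) * ((C.L n + B' + n).factorial : ℝ)) := by
  obtain ⟨_, _, htot, _, _⟩ := C.validCL_sound h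
  have hE := C.EsumL_eq_NZ h
  have hD : (((2 : ℝ) ^ C.T) ^ 2) ^ n ≠ 0 := by positivity
  have hdeg : (C.NZ n CL * UZ w (B' + 1)).natDegree ≤ C.L n + B' :=
    Polynomial.natDegree_mul_le.trans (Nat.add_le_add (C.natDegree_NZ_le htot) (natDegree_UZ_le w B'))
  have hb' : ∀ j, |(C.NZ n CL * UZ w (B' + 1)).coeff j| < 2 ^ C.H := fun j =>
    lt_of_le_of_lt (C.abs_coeff_NZ_mul_UZ_le n CL w (B' + 1) j) (by exact_mod_cast hb)
  rw [Pcl_eq, wpk_eq, ← Polynomial.eval_mul,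
    ZvalZ_congr (d' := fun K => (C.NZ n CL * UZ w (B' + 1)).coeff K)
      (fun K hK => C.dZP_eq_coeff _ (by omega) hb' hK)]
  have key := simplexFunctional_eq_ZvalZ
    (EsumL (fun s : Fin C.nL => C.phR s) n (fun s : Fin C.nL => m₁ s) (fun s : Fin C.nL => m₂ s) *
      (UZ w (B' + 1)).map (Int.castRingHom ℝ))
    (fun K => (C.NZ n CL * UZ w (B' + 1)).coeff K) hD n 0 rn rd (C.L n + B') hrd ?_ ?_
  · rw [key, Nat.factorial_zero, Nat.cast_one, one_mul, add_zero]
  · rw [hE, mul_assoc, ← Polynomial.map_mul]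
    exact (Polynomial.natDegree_C_mul_le _ _).trans (Polynomial.natDegree_map_le.trans hdeg)
  · intro K _
    rw [hE, mul_assoc, ← Polynomial.map_mul, Polynomial.coeff_C_mul, Polynomial.coeff_map, eq_div_iff hD]
    simp only [eq_intCast, one_div, inv_pow]
    field_simp

/-! ### The `I`-side per generator pair -/

/-- `(Q_xQ_y)_t = QQ`. [cite: Polymath8b2014, Theorem 3.13, eq. (35)] -/
private theorem coeff_QR_mul (x y t : ℕ) : (C.QR x * C.QR y).coeff t = ((C.QQ x y t : ℤ) : ℝ) := by
  rw [Polynomial.coeff_mul, Finset.Nat.sum_antidiagonal_eq_sum_range_succ_mk, QQ, zsum_eq, Int.cast_sum]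
  refine Finset.sum_congr rfl fun i _ => ?_
  rw [coeff_QR, coeff_QR, Int.cast_mul]

/-- `deg (Q_xQ_y) < 2A+1` (internal; as `ProdCert.natDegree_QR_mul_lt`). [folklore] -/
private theorem natDegree_QR_mul_lt (x y : ℕ) : (C.QR x * C.QR y).natDegree < 2 * C.A + 1 :=
  Nat.lt_succ_of_le (Polynomial.natDegree_mul_le.trans
    (by have := C.natDegree_QR_le x; have := C.natDegree_QR_le y; omega))

/-- **The `I`-side of a certified pair**: `Σ_t (Q_xQ_y)_t Λ_{k+1,t,(ed+en)/ed}(E_{k+1}(sg x, sg y)) = v / DenI`.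
[cite: Polymath8b2014, Theorem 3.13, eq. (35)] -/
theorem Ipair_eq {x y : ℕ} {v : ℤ} (h : C.okI x y v = true) (hed : 0 < C.ed) :
    ∑ t ∈ Finset.range (2 * C.A + 1), (C.QR x * C.QR y).coeff t *
        simplexFunctional (C.k + 1) t (((C.ed + C.en : ℕ) : ℝ) / C.ed)
          (EsumL (fun s : Fin C.nL => C.phR s) (C.k + 1) (fun s : Fin C.nL => C.sgc x s)
            (fun s : Fin C.nL => C.sgc y s)) =
      (v : ℝ) / ((((2 : ℝ) ^ C.T) ^ 2) ^ (C.k + 1) * (C.ed : ℝ) ^ (C.L (C.k + 1) + 2 * C.A + (C.k + 1)) *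
        ((C.L (C.k + 1) + 2 * C.A + (C.k + 1)).factorial : ℝ)) := by
  simp only [okI, validI, Bool.and_eq_true, Nat.blt_eq, pow2_eq, beq_iff_eq] at h
  obtain ⟨⟨hval, hb⟩, hv⟩ := h
  have hU : ∑ c ∈ Finset.range (2 * C.A + 1),
      Polynomial.monomial c (((C.QQ x y c : ℤ) : ℝ) * (c.factorial : ℝ)) =
        (UZ (C.UI x y) (2 * C.A + 1)).map (Int.castRingHom ℝ) := by
    rw [UZ, Polynomial.map_sum]
    refine Finset.sum_congr rfl fun c _ => ?_
    rw [Polynomial.map_monomial, UI]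
    simp
  simp only [coeff_QR_mul]
  rw [sum_mul_simplexFunctional, hU, C.pair_value hval (C.UI x y) (2 * C.A) hb (C.ed + C.en) C.ed hed, ← hv, IP,
    dZI, MdI]
  push_cast
  ring

/-! ### The `J`-side: convolution transforms, aggregation by signature, the pair identity -/

/-- Internal arithmetic (`bw_spec`). [folklore] -/
private theorem bw_spec {u j : ℕ} (hu : u ≤ C.A) (hj : j ≤ C.S) :
    (C.bw u j : ℝ) * ((u + j + 1).factorial : ℝ) =
      (u.factorial : ℝ) * (j.factorial : ℝ) * ((C.A + C.S + 1).factorial : ℝ) := by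
  have hdvd : (u + j + 1).factorial ∣ (C.A + C.S + 1).factorial := Nat.factorial_dvd_factorial (by omega)
  have h : C.bw u j * (u + j + 1).factorial = u.factorial * j.factorial * (C.A + C.S + 1).factorial := by
    rw [bw, mul_assoc, Nat.div_mul_cancel hdvd]
  exact_mod_cast h

/-- `[X^N] T_{φ_s} Q_x = Vint_{x,s,N} / (2^T (A+S+1)!)`. [cite: Polymath8b2014, Lemma 4.4] -/
theorem coeff_convT (x s N : ℕ) :
    (convT C.A C.S (C.phR s) (C.QR x)).coeff N =
      ((C.Vint x s N : ℤ) : ℝ) / (2 ^ C.T * ((C.A + C.S + 1).factorial : ℝ)) := by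
  rw [convT, Polynomial.finsetSum_coeff, Vint, zsum_eq, Int.cast_sum, Finset.sum_div]
  refine Finset.sum_congr rfl fun u hu => ?_
  rw [Polynomial.finsetSum_coeff, zsum_eq, Int.cast_sum, Finset.sum_div]
  refine Finset.sum_congr rfl fun j hj => ?_
  have hu' := Nat.lt_succ_iff.1 (Finset.mem_range.1 hu)
  have hj' := Nat.lt_succ_iff.1 (Finset.mem_range.1 hj)
  rw [Polynomial.coeff_monomial]
  split_ifs with h
  · rw [coeff_QR, coeff_phR]
    have hf : ((u + j + 1).factorial : ℝ) ≠ 0 := by positivity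
    have hF : ((C.A + C.S + 1).factorial : ℝ) ≠ 0 := by positivity
    have h2 : (2 : ℝ) ^ C.T ≠ 0 := by positivity
    have hb' : (C.bw u j : ℝ) = (u.factorial : ℝ) * (j.factorial : ℝ) * ((C.A + C.S + 1).factorial : ℝ) /
        ((u + j + 1).factorial : ℝ) := by
      rw [eq_div_iff hf]; exact C.bw_spec hu' hj'
    push_cast
    rw [hb']
    field_simp
  · simp

/-- `deg T_{φ_s} Q_x ≤ A+S+1`. [cite: Polymath8b2014, Lemma 4.4] -/
theorem natDegree_convT_le (x s : ℕ) : (convT C.A C.S (C.phR s) (C.QR x)).natDegree ≤ C.A + C.S + 1 :=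
  Polynomial.natDegree_sum_le_of_forall_le _ _ fun u hu =>
    Polynomial.natDegree_sum_le_of_forall_le _ _ fun _ hs =>
      (Polynomial.natDegree_monomial_le _).trans (by
        have := Finset.mem_range.1 hu; have := Finset.mem_range.1 hs; omega)

/-- the POINTED generators `(p, s)`: profile `s` occurs in `sg p`. [cite: Polymath8b2014, Section 7.2] -/
def PG : Finset (Σ _ : Fin C.G, Fin C.nL) :=
  Finset.univ.sigma fun p : Fin C.G => Finset.univ.filter fun s : Fin C.nL => 1 ≤ C.sgc p s

/-- the aggregated convolution transform `W_a = Σ_{(p,s) ↦ a} T_{φ_s} Q_p`. [cite: Polymath8b2014, Section 7.2] -/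
noncomputable def WR (a : ℕ) : ℝ[X] :=
  ∑ u ∈ C.PG, if C.jxf u.1 u.2 = a then convT C.A C.S (C.phR u.2) (C.QR u.1) else 0

/-- `deg W_a ≤ A+S+1`. [cite: Polymath8b2014, Lemma 4.4] -/
theorem natDegree_WR_le (a : ℕ) : (C.WR a).natDegree ≤ C.A + C.S + 1 :=
  Polynomial.natDegree_sum_le_of_forall_le _ _ fun u _ => by
    split_ifs
    · exact C.natDegree_convT_le _ _
    · simp

/-- **The verified table gives the coefficients of `W_a`**: `[X^N] W_a = wv[a][N] / (2^T (A+S+1)!)`.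
[cite: Polymath8b2014, Section 7.2] -/
theorem coeff_WR (hW : C.validW = true) {a : ℕ} (ha : a < C.NJ) (N : ℕ) :
    (C.WR a).coeff N = ((C.wvq a N : ℤ) : ℝ) / (2 ^ C.T * ((C.A + C.S + 1).factorial : ℝ)) := by
  have key : (C.WR a).coeff N = ((C.WV a N : ℤ) : ℝ) / (2 ^ C.T * ((C.A + C.S + 1).factorial : ℝ)) := by
    rw [WR, Polynomial.finsetSum_coeff, WV, zsum_eq, PG, Finset.sum_sigma, Finset.sum_range, Int.cast_sum,
      Finset.sum_div]
    refine Finset.sum_congr rfl fun p _ => ?_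
    rw [zsum_eq, Finset.sum_range, Int.cast_sum, Finset.sum_div, Finset.sum_filter]
    refine Finset.sum_congr rfl fun s _ => ?_
    by_cases h1 : 1 ≤ C.sgc p s <;> by_cases h2 : C.jxf p s = a <;> simp [h1, h2, coeff_convT]
  by_cases hN : N ≤ C.A + C.S + 1
  · simp only [validW, nall_iff, beq_iff_eq] at hW
    rw [key, ← hW a ha N (by omega)]
  · rw [C.wvq_eq_zero (by omega), Int.cast_zero, zero_div,
      Polynomial.coeff_eq_zero_of_natDegree_lt (lt_of_le_of_lt (C.natDegree_WR_le a) (by omega))]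

/-- `deg (W_aW_b) < Cmax+1`. [cite: Polymath8b2014, Lemma 4.4] -/
theorem natDegree_WW_lt (a b : ℕ) : (C.WR a * C.WR b).natDegree < C.Cmax + 1 :=
  Nat.lt_succ_of_le (Polynomial.natDegree_mul_le.trans
    (by have := C.natDegree_WR_le a; have := C.natDegree_WR_le b; rw [Cmax]; omega))

/-- `[(W_aW_b)]_N = VV_{ab,N} / DU`. [cite: Polymath8b2014, Lemma 4.4] -/
theorem coeff_WW (hW : C.validW = true) {a b : ℕ} (ha : a < C.NJ) (hb : b < C.NJ) (N : ℕ) :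
    (C.WR a * C.WR b).coeff N = ((C.VV a b N : ℤ) : ℝ) / (C.DU : ℝ) := by
  rw [Polynomial.coeff_mul, Finset.Nat.sum_antidiagonal_eq_sum_range_succ_mk, VV, zsum_eq, Int.cast_sum,
    Finset.sum_div]
  refine Finset.sum_congr rfl fun j _ => ?_
  rw [C.coeff_WR hW ha, C.coeff_WR hW hb, DU, Nat.cast_mul, pow2_eq]
  push_cast
  have hf : ((C.A + C.S + 1).factorial : ℝ) ≠ 0 := by positivity
  have h2 : (2 : ℝ) ^ C.T ≠ 0 := by positivity
  field_simp

/-- the shifted coefficients: `shiftCoeff (W_aW_b) (Cmax+1) (2en/ed) c = Uint_c / (DU · ed^Cmax)`.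
[cite: Polymath8b2014, Lemma 4.4] -/
theorem shiftCoeff_WW (hW : C.validW = true) {a b : ℕ} (ha : a < C.NJ) (hb : b < C.NJ) (hed : 0 < C.ed) (c : ℕ) :
    shiftCoeff (C.WR a * C.WR b) (C.Cmax + 1) (((2 * C.en : ℕ) : ℝ) / C.ed) c =
      ((C.Uint a b c : ℤ) : ℝ) / ((C.DU : ℝ) * (C.ed : ℝ) ^ C.Cmax) := by
  have hed' : (C.ed : ℝ) ≠ 0 := by positivity
  rw [shiftCoeff, Uint, zsum_eq, Int.cast_sum, Finset.sum_div]
  refine Finset.sum_congr rfl fun N hN => ?_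
  have hN : N ≤ C.Cmax := Nat.lt_succ_iff.1 (Finset.mem_range.1 hN)
  rw [C.coeff_WW hW ha hb]
  have h2 : (C.ed : ℝ) ^ C.Cmax = (C.ed : ℝ) ^ (N - c) * (C.ed : ℝ) ^ (C.Cmax - (N - c)) := by
    rw [← pow_add]; congr 1; omega
  rw [h2, div_pow]
  push_cast
  field_simp

/-- the `J`-weight of the signature pair `(a, b)` applied to a polynomial `U`:
`Σ_c shiftCoeff(U)_c · Λ_{k,c,(ed−en)/ed}(E_k(sigJ a, sigJ b))` (additive in `U`). [cite: Polymath8b2014, Section 7.2] -/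
noncomputable def gJ (a b : ℕ) (U : ℝ[X]) : ℝ :=
  ∑ c ∈ Finset.range (C.Cmax + 1), shiftCoeff U (C.Cmax + 1) (((2 * C.en : ℕ) : ℝ) / C.ed) c *
    simplexFunctional C.k c (((C.ed - C.en : ℕ) : ℝ) / C.ed)
      (EsumL (fun s : Fin C.nL => C.phR s) C.k (fun s : Fin C.nL => C.sgJc a s) (fun s : Fin C.nL => C.sgJc b s))

/-- additivity of `gJ`. [folklore] -/
private theorem gJ_add (a b : ℕ) (U U' : ℝ[X]) : C.gJ a b (U + U') = C.gJ a b U + C.gJ a b U' := by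
  simp only [gJ, shiftCoeff, Polynomial.coeff_add, add_mul, Finset.sum_add_distrib]

/-- `gJ 0 = 0`. [folklore] -/
private theorem gJ_zero (a b : ℕ) : C.gJ a b 0 = 0 := by
  simp [gJ, shiftCoeff]

/-- `gJ` is symmetric on products. [folklore] -/
private theorem gJ_comm (a b : ℕ) (U U' : ℝ[X]) : C.gJ a b (U * U') = C.gJ b a (U' * U) := by
  simp only [gJ]
  rw [mul_comm U, EsumL_comm]

/-- **The `J`-side of a certified signature pair**: `gJ a b (W_aW_b) = v / DenJ`. [cite: Polymath8b2014, Theorem 3.13, eq. (35)] -/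
theorem Jpair_eq {a b : ℕ} {v : ℤ} (h : C.okJ a b v = true) (hW : C.validW = true) (ha : a < C.NJ) (hb : b < C.NJ)
    (hed : 0 < C.ed) :
    C.gJ a b (C.WR a * C.WR b) =
      (v : ℝ) / ((C.DU : ℝ) * (C.ed : ℝ) ^ C.Cmax *
        ((((2 : ℝ) ^ C.T) ^ 2) ^ C.k * (C.ed : ℝ) ^ (C.L C.k + C.Cmax + C.k) *
          ((C.L C.k + C.Cmax + C.k).factorial : ℝ))) := by
  simp only [okJ, validJ, Bool.and_eq_true, Nat.blt_eq, pow2_eq, beq_iff_eq] at h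
  obtain ⟨⟨hval, hbnd⟩, hv⟩ := h
  have hed' : (C.ed : ℝ) ≠ 0 := by positivity
  have hDU : (C.DU : ℝ) ≠ 0 := by rw [DU, Nat.cast_mul, pow2_eq]; push_cast; positivity
  have hU : ∑ c ∈ Finset.range (C.Cmax + 1),
      Polynomial.monomial c (((C.Uint a b c : ℤ) : ℝ) * (c.factorial : ℝ)) =
        (UZ (C.UJ a b) (C.Cmax + 1)).map (Int.castRingHom ℝ) := by
    rw [UZ, Polynomial.map_sum]
    refine Finset.sum_congr rfl fun c _ => ?_
    rw [Polynomial.map_monomial, UJ]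
    simp
  have h1 : C.gJ a b (C.WR a * C.WR b) = (1 / ((C.DU : ℝ) * (C.ed : ℝ) ^ C.Cmax)) *
      ∑ c ∈ Finset.range (C.Cmax + 1), ((C.Uint a b c : ℤ) : ℝ) *
        simplexFunctional C.k c (((C.ed - C.en : ℕ) : ℝ) / C.ed)
          (EsumL (fun s : Fin C.nL => C.phR s) C.k (fun s : Fin C.nL => C.sgJc a s)
            (fun s : Fin C.nL => C.sgJc b s)) := by
    rw [gJ, Finset.mul_sum]
    refine Finset.sum_congr rfl fun c _ => ?_
    rw [C.shiftCoeff_WW hW ha hb hed c]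
    field_simp
  rw [h1, sum_mul_simplexFunctional, hU, C.pair_value hval (C.UJ a b) C.Cmax hbnd (C.ed - C.en) C.ed hed, ← hv,
    JP, dZJ, MdJ]
  have hD : (((2 : ℝ) ^ C.T) ^ 2) ^ C.k ≠ 0 := by positivity
  have hf : (((C.L C.k + C.Cmax + C.k).factorial : ℕ) : ℝ) ≠ 0 := by positivity
  push_cast
  field_simp

/-- the pointing map, unpacked. [cite: Polymath8b2014, Section 7.2] -/
theorem validJx_sound (h : C.validJx = true) {x s : ℕ} (hx : x < C.G) (hs : s < C.nL) (hp : 1 ≤ C.sgc x s) :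
    C.jxf x s < C.NJ ∧ ∀ u < C.nL, C.sgJc (C.jxf x s) u = if u = s then C.sgc x u - 1 else C.sgc x u := by
  simp only [validJx, nall_iff, Bool.or_eq_true, Bool.and_eq_true, Nat.ble_eq, Nat.blt_eq, beq_iff_eq] at h
  rcases h x hx s hs with h0 | ⟨hj, hu⟩
  · omega
  · exact ⟨hj, hu⟩

/-- the pointed signature IS `sg p − e_s`. [cite: Polymath8b2014, Section 7.2] -/
theorem sgJ_eq_update (h : C.validJx = true) (p : Fin C.G) (s : Fin C.nL) (hp : 1 ≤ C.sgc p s) :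
    (fun u : Fin C.nL => C.sgJc (C.jxf p s) u) =
      Function.update (fun u : Fin C.nL => C.sgc p u) s (C.sgc p s - 1) := by
  funext u
  rw [Function.update_apply, (C.validJx_sound h p.isLt s.isLt hp).2 u u.isLt]
  by_cases hu : u = s
  · subst hu; simp
  · rw [if_neg (fun h' => hu (Fin.ext h')), if_neg hu]

/-- **Regrouping the `J`-sum by signatures**: `Σ_{(p,s)} Σ_{(q,t)} gJ (j ps) (j qt) (V_{ps} V_{qt}) = Σ_a Σ_b gJ a b (W_aW_b)`.
[cite: Polymath8b2014, Section 7.2] -/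
theorem J_regroup (hJx : C.validJx = true) :
    ∑ u ∈ C.PG, ∑ w ∈ C.PG, C.gJ (C.jxf u.1 u.2) (C.jxf w.1 w.2)
        (convT C.A C.S (C.phR u.2) (C.QR u.1) * convT C.A C.S (C.phR w.2) (C.QR w.1)) =
      ∑ a ∈ Finset.range C.NJ, ∑ b ∈ Finset.range C.NJ, C.gJ a b (C.WR a * C.WR b) := by
  have hj : ∀ u ∈ C.PG, C.jxf u.1 u.2 < C.NJ := by
    intro u hu
    simp only [PG, Finset.mem_sigma, Finset.mem_univ, Finset.mem_filter, true_and] at hu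
    exact (C.validJx_sound hJx u.1.isLt u.2.isLt hu).1
  exact regroup_lemma C.PG (fun u => C.jxf u.1 u.2) (fun u => convT C.A C.S (C.phR u.2) (C.QR u.1)) C.NJ hj
    (fun a b U => C.gJ a b U) (C.gJ_add) (C.gJ_zero)

/-! ### Assembly -/

/-- the certificate's real data. [cite: Polymath8b2014, Section 7.2] -/
noncomputable def D : SymLData (Fin C.nL) (Fin C.G) where
  A := C.A
  S := C.S
  φ := fun s => C.phR s
  sg := fun p s => C.sgc p s
  Q := fun p => C.QR p
  degφ := fun s => C.natDegree_phR_le s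
  degQ := fun p => C.natDegree_QR_le p

/-- `0 < DenI`. [cite: Polymath8b2014, Theorem 3.13, eq. (35)] -/
theorem DenI_pos (hed : 0 < C.ed) : (0 : ℝ) < C.DenI := by
  rw [DenI, pow2_eq]; push_cast; positivity

/-- `0 < DenJ`. [cite: Polymath8b2014, Theorem 3.13, eq. (35)] -/
theorem DenJ_pos (hed : 0 < C.ed) : (0 : ℝ) < C.DenJ := by
  rw [DenJ, DU, pow2_eq]; push_cast; positivity

/-- **Soundness of the labelled product-radial kernel checker (tabulated form)**: per-pair kernel facts
`okI x y (tI x y)` (`y ≤ x < G`) and `okJ a b (tJ a b)` (`b ≤ a < NJ`) — each one `decide +kernel` — and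
`checkTab C tI tJ = true` give a Polymath test function on `R_{k+1}` with `M_{k+1,ε}(F) > 4`, `ε = en/ed`.
[cite: Polymath8b2014, Theorem 3.13, eq. (35)] -/
theorem sound_tab (C : SymLCert) (G₀ NJ₀ : ℕ) (tI tJ : ℕ → ℕ → ℤ) (hG : C.G = G₀) (hNJ : C.NJ = NJ₀)
    (hPI : pall (fun x => pall (fun y => C.okI x y (tI x y) = true) (x + 1)) G₀)
    (hPJ : pall (fun a => pall (fun b => C.okJ a b (tJ a b) = true) (a + 1)) NJ₀)
    (h : SymLCert.checkTab C tI tJ = true) :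
    ∃ (ε : ℝ) (F : (Fin (C.k + 1) → ℝ) → ℝ), 0 < ε ∧ ε < 1 ∧ IsPolymathTestFunction (C.k + 1) ε F ∧
      4 < polymathFunctional (C.k + 1) ε F := by
  subst hG hNJ
  have hI' : ∀ x < C.G, ∀ y ≤ x, C.okI x y (tI x y) = true := fun x hx y hy =>
    (pall_iff _ _).1 ((pall_iff _ _).1 hPI x hx) y (by omega)
  have hJ' : ∀ a < C.NJ, ∀ b ≤ a, C.okJ a b (tJ a b) = true := fun a ha b hb =>
    (pall_iff _ _).1 ((pall_iff _ _).1 hPJ a ha) b (by omega)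
  simp only [checkTab, Bool.and_eq_true, Nat.blt_eq, decide_eq_true_eq] at h
  obtain ⟨⟨⟨⟨⟨hen0, hen⟩, hJx⟩, hW⟩, hIpos⟩, hineq⟩ := h
  have hed : 0 < C.ed := lt_trans hen0 hen
  have hedR : (0 : ℝ) < C.ed := by exact_mod_cast hed
  have hε0 : (0 : ℝ) < (C.en : ℝ) / C.ed := div_pos (by exact_mod_cast hen0) hedR
  have hε1 : (C.en : ℝ) / C.ed < 1 := by rw [div_lt_one hedR]; exact_mod_cast hen
  have hρI : (1 : ℝ) + (C.en : ℝ) / C.ed = ((C.ed + C.en : ℕ) : ℝ) / C.ed := by push_cast; field_simp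
  have hρJ : (1 : ℝ) - (C.en : ℝ) / C.ed = ((C.ed - C.en : ℕ) : ℝ) / C.ed := by
    rw [Nat.cast_sub hen.le]; field_simp
  have hd : (2 : ℝ) * ((C.en : ℝ) / C.ed) = ((2 * C.en : ℕ) : ℝ) / C.ed := by push_cast; ring
  -- the `I`-side: denominators, symmetry, tables
  set DIR : ℝ := (((2 : ℝ) ^ C.T) ^ 2) ^ (C.k + 1) * (C.ed : ℝ) ^ (C.L (C.k + 1) + 2 * C.A + (C.k + 1)) *
    ((C.L (C.k + 1) + 2 * C.A + (C.k + 1)).factorial : ℝ) with hDIR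
  set IR : ℕ → ℕ → ℝ := fun x y => ∑ t ∈ Finset.range (2 * C.A + 1), (C.QR x * C.QR y).coeff t *
    simplexFunctional (C.k + 1) t (((C.ed + C.en : ℕ) : ℝ) / C.ed)
      (EsumL (fun s : Fin C.nL => C.phR s) (C.k + 1) (fun s : Fin C.nL => C.sgc x s)
        (fun s : Fin C.nL => C.sgc y s)) with hIR
  have IR_comm : ∀ x y, IR x y = IR y x := by
    intro x y; simp only [hIR]; rw [mul_comm (C.QR x), EsumL_comm]
  have IR_tab : ∀ x < C.G, ∀ y < C.G, IR x y = ((symT tI x y : ℤ) : ℝ) / DIR := by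
    intro x hx y hy
    by_cases hyx : y ≤ x
    · rw [symT, if_pos hyx]; exact C.Ipair_eq (hI' x hx y hyx) hed
    · rw [symT, if_neg hyx, IR_comm]; exact C.Ipair_eq (hI' y hy x (by omega)) hed
  have hIform : ∑ p : Fin C.G, ∑ q : Fin C.G, ∑ c ∈ Finset.range (2 * C.A + 1),
      (C.QR p * C.QR q).coeff c * simplexFunctional (C.k + 1) c (1 + (C.en : ℝ) / C.ed)
        (EsumL (fun s : Fin C.nL => C.phR s) (C.k + 1) (fun s : Fin C.nL => C.sgc p s)
          (fun s : Fin C.nL => C.sgc q s)) =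
      ((zsum (fun x => zsum (fun y => symT tI x y) C.G) C.G : ℤ) : ℝ) / DIR := by
    rw [hρI, zsum_eq, Finset.sum_range, Int.cast_sum, Finset.sum_div]
    refine Finset.sum_congr rfl fun p _ => ?_
    rw [zsum_eq, Finset.sum_range, Int.cast_sum, Finset.sum_div]
    refine Finset.sum_congr rfl fun q _ => ?_
    exact IR_tab p p.isLt q q.isLt
  -- the `J`-side
  set DJR : ℝ := (C.DU : ℝ) * (C.ed : ℝ) ^ C.Cmax *
    ((((2 : ℝ) ^ C.T) ^ 2) ^ C.k * (C.ed : ℝ) ^ (C.L C.k + C.Cmax + C.k) *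
      ((C.L C.k + C.Cmax + C.k).factorial : ℝ)) with hDJR
  have JR_tab : ∀ a < C.NJ, ∀ b < C.NJ, C.gJ a b (C.WR a * C.WR b) = ((symT tJ a b : ℤ) : ℝ) / DJR := by
    intro a ha b hb
    by_cases hba : b ≤ a
    · rw [symT, if_pos hba]; exact C.Jpair_eq (hJ' a ha b hba) hW ha hb hed
    · rw [symT, if_neg hba, gJ_comm]; exact C.Jpair_eq (hJ' b hb a (by omega)) hW hb ha hed
  have hJform : ∑ p : Fin C.G, ∑ s ∈ Finset.univ.filter (fun s : Fin C.nL => 1 ≤ C.sgc p s),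
      ∑ q : Fin C.G, ∑ t ∈ Finset.univ.filter (fun t : Fin C.nL => 1 ≤ C.sgc q t),
        ∑ c ∈ Finset.range (C.Cmax + 1),
          shiftCoeff (convT C.A C.S (C.phR s) (C.QR p) * convT C.A C.S (C.phR t) (C.QR q)) (C.Cmax + 1)
              (2 * ((C.en : ℝ) / C.ed)) c *
            simplexFunctional C.k c (1 - (C.en : ℝ) / C.ed)
              (EsumL (fun s : Fin C.nL => C.phR s) C.k
                (Function.update (fun u : Fin C.nL => C.sgc p u) s (C.sgc p s - 1))
                (Function.update (fun u : Fin C.nL => C.sgc q u) t (C.sgc q t - 1))) =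
      ((zsum (fun a => zsum (fun b => symT tJ a b) C.NJ) C.NJ : ℤ) : ℝ) / DJR := by
    rw [hρJ, hd]
    have e1 : ∀ (p : Fin C.G), ∀ s ∈ Finset.univ.filter (fun s : Fin C.nL => 1 ≤ C.sgc p s),
        ∀ (q : Fin C.G), ∀ t ∈ Finset.univ.filter (fun t : Fin C.nL => 1 ≤ C.sgc q t),
        ∑ c ∈ Finset.range (C.Cmax + 1),
          shiftCoeff (convT C.A C.S (C.phR s) (C.QR p) * convT C.A C.S (C.phR t) (C.QR q)) (C.Cmax + 1)
              (((2 * C.en : ℕ) : ℝ) / C.ed) c *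
            simplexFunctional C.k c (((C.ed - C.en : ℕ) : ℝ) / C.ed)
              (EsumL (fun s : Fin C.nL => C.phR s) C.k
                (Function.update (fun u : Fin C.nL => C.sgc p u) s (C.sgc p s - 1))
                (Function.update (fun u : Fin C.nL => C.sgc q u) t (C.sgc q t - 1))) =
        C.gJ (C.jxf p s) (C.jxf q t) (convT C.A C.S (C.phR s) (C.QR p) * convT C.A C.S (C.phR t) (C.QR q)) := by
      intro p s hs q t ht
      have hs' := (Finset.mem_filter.1 hs).2
      have ht' := (Finset.mem_filter.1 ht).2
      rw [← C.sgJ_eq_update hJx p s hs', ← C.sgJ_eq_update hJx q t ht', gJ]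
    rw [Finset.sum_congr rfl fun p _ => Finset.sum_congr rfl fun s hs => Finset.sum_congr rfl fun q _ =>
      Finset.sum_congr rfl fun t ht => e1 p s hs q t ht]
    have e2 : (∑ p : Fin C.G, ∑ s ∈ Finset.univ.filter (fun s : Fin C.nL => 1 ≤ C.sgc p s),
        ∑ q : Fin C.G, ∑ t ∈ Finset.univ.filter (fun t : Fin C.nL => 1 ≤ C.sgc q t),
          C.gJ (C.jxf p s) (C.jxf q t) (convT C.A C.S (C.phR s) (C.QR p) * convT C.A C.S (C.phR t) (C.QR q))) =
        ∑ u ∈ C.PG, ∑ w ∈ C.PG, C.gJ (C.jxf u.1 u.2) (C.jxf w.1 w.2)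
          (convT C.A C.S (C.phR u.2) (C.QR u.1) * convT C.A C.S (C.phR w.2) (C.QR w.1)) := by
      rw [PG, Finset.sum_sigma]
      refine Finset.sum_congr rfl fun p _ => Finset.sum_congr rfl fun s _ => ?_
      rw [Finset.sum_sigma]
    rw [e2, C.J_regroup hJx, zsum_eq, Int.cast_sum, Finset.sum_div]
    refine Finset.sum_congr rfl fun a ha => ?_
    rw [zsum_eq, Int.cast_sum, Finset.sum_div]
    refine Finset.sum_congr rfl fun b hb => ?_
    exact JR_tab a (Finset.mem_range.1 ha) b (Finset.mem_range.1 hb)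
  -- the two values as Isum/DenI and Jsum/DenJ
  have hDIe : (((zsum (fun x => zsum (fun y => symT tI x y) C.G) C.G : ℤ) : ℝ)) / DIR =
      ((zsum (fun x => zsum (fun y => symT tI x y) C.G) C.G : ℤ) : ℝ) / (C.DenI : ℝ) := by
    congr 1
    rw [hDIR, DenI, Nat.cast_mul, Nat.cast_mul, pow2_eq]
    push_cast
    ring
  have hDJe : (((zsum (fun a => zsum (fun b => symT tJ a b) C.NJ) C.NJ : ℤ) : ℝ)) / DJR =
      ((zsum (fun a => zsum (fun b => symT tJ a b) C.NJ) C.NJ : ℤ) : ℝ) / (C.DenJ : ℝ) := by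
    congr 1
    rw [hDJR, DenJ, Nat.cast_mul, Nat.cast_mul, Nat.cast_mul, Nat.cast_mul, pow2_eq]
    push_cast
    ring
  have hDIp := C.DenI_pos hed
  have hDJp := C.DenJ_pos hed
  set Isum := zsum (fun x => zsum (fun y => symT tI x y) C.G) C.G with hIsum
  set Jsum := zsum (fun a => zsum (fun b => symT tJ a b) C.NJ) C.NJ with hJsum
  have hIposR : (0 : ℝ) < (Isum : ℝ) / (C.DenI : ℝ) := div_pos (by exact_mod_cast hIpos) hDIp
  have hineqR : (4 : ℝ) * (Isum : ℝ) * (C.DenJ : ℝ) < ((C.k + 1 : ℕ) : ℝ) * (Jsum : ℝ) * (C.DenI : ℝ) := by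
    exact_mod_cast hineq
  have hcert : 4 * ((Isum : ℝ) / (C.DenI : ℝ)) < (C.k + 1 : ℝ) * ((Jsum : ℝ) / (C.DenJ : ℝ)) := by
    have hDIn := hDIp.ne'
    have hDJn := hDJp.ne'
    rw [show 4 * ((Isum : ℝ) / (C.DenI : ℝ)) = (4 * (Isum : ℝ) * C.DenJ) / ((C.DenI : ℝ) * C.DenJ) by
        field_simp,
      show (C.k + 1 : ℝ) * ((Jsum : ℝ) / (C.DenJ : ℝ)) =
        (((C.k + 1 : ℕ) : ℝ) * (Jsum : ℝ) * C.DenI) / ((C.DenI : ℝ) * C.DenJ) by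
          push_cast; field_simp]
    exact div_lt_div_of_pos_right hineqR (mul_pos hDIp hDJp)
  have hBJ : ∀ (p q : Fin C.G) (s t : Fin C.nL),
      (convT C.D.A C.D.S (C.D.φ s) (C.D.Q p) * convT C.D.A C.D.S (C.D.φ t) (C.D.Q q)).natDegree < C.Cmax + 1 :=
    fun p q s t => by
      show (convT C.A C.S (C.phR s) (C.QR p) * convT C.A C.S (C.phR t) (C.QR q)).natDegree < C.Cmax + 1
      exact Nat.lt_succ_of_le (Polynomial.natDegree_mul_le.trans
        (by have := C.natDegree_convT_le p s; have := C.natDegree_convT_le q t; rw [Cmax]; omega))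
  obtain ⟨F, hF, hM⟩ := C.D.exists_polymathFunctional_gt_four C.k hε0 hε1
    (BI := 2 * C.A + 1) (BJ := C.Cmax + 1) (fun p q => C.natDegree_QR_mul_lt p q) hBJ
    (hIform.trans hDIe) (hJform.trans hDJe) hIposR hcert
  exact ⟨(C.en : ℝ) / C.ed, F, hε0, hε1, hF, hM⟩

end Spec

end SymLCert

end Literature.NumberTheory.Sieve.PolymathCert
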